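import Literature.AlgebraicGeometry.Motives.AdaptedAlgebraicCharts
import Literature.AlgebraicTopology.Homotopy.EhresmannRelative
import Literature.AlgebraicGeometry.Motives.ComplexPointsEhresmann
import Literature.AlgebraicGeometry.Resolution.BlowupSNC
import Literature.AlgebraicGeometry.Resolution.SncSaturatedCentre
import Literature.AlgebraicGeometry.Resolution.StrictNormalCrossingsDescent
import Literature.AlgebraicGeometry.Resolution.LogResolutionOfClosedSubset
import Literature.AlgebraicGeometry.Resolution.GenericSmoothStrata
import Literature.AlgebraicGeometry.Resolution.PrincipalizationToResolution
import Literature.AlgebraicGeometry.Resolution.SmoothOfRegularPerfectField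
import Literature.AlgebraicGeometry.Motives.VarietiesRegularProofs
import Literature.AlgebraicGeometry.Motives.AbelianVarietyProofs
import Literature.AlgebraicTopology.Homotopy.LocallyTrivialFibrationGlue
import Literature.NumberTheory.Transcendental.AnalytificationSecondCountableProofs
import Literature.AlgebraicGeometry.HodgeTheory.LefschetzOneOneChowClosed
import Literature.AlgebraicGeometry.HodgeTheory.AlgebraicityLocusComplDichotomy
import Literature.AlgebraicGeometry.HodgeTheory.AlgebraicityLocusFromFacts
import Literature.AlgebraicGeometry.HodgeTheory.AlgebraicityLocusCurves
import Literature.AlgebraicGeometry.Motives.CurveThroughTwoPointsProofs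
import Mathlib.AlgebraicGeometry.FunctionField
import HarnessLib

/-!
# The algebraicity locus is a countable union of closed algebraic subsets: discharge of `charlesSchnell_algebraicityLocus_iUnion_closed`

Topic `Literature/AlgebraicGeometry/HodgeTheory` (family `hodge`). This file completes the proof
programme of the named fact `charlesSchnell_algebraicityLocus_iUnion_closed` of
`HodgeTheory/AlgebraicityLocus.lean` (Charles–Schnell 2014, Prop. 11.3.11; Voisin, *Hodge Theory
II*, §3.3.1 and §7.3.2): for a smooth projective family `f : 𝒳 → S` of quasi-projective complex
varieties over a smooth `S` and `A ∈ H²ᵖ(𝒳(ℂ); ℂ)`, the locus of `t ∈ S(ℂ)` where `A|_{𝒳_t}` is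
algebraic is a countable union of the complex points of Zariski-closed subsets of `S`.

The earlier files of the programme reduce the statement (hyperplane witness families,
completeness of the witnesses, assembly over the witness families, uniform codimension over the
generic part of an irreducible closed subset of a parameter space, Mumford's curve lemma) to a
DICHOTOMY: over a dense open of every irreducible closed `Y` of a parameter space, the class `A`
dies off the slice of the closed subfamily `𝒵` either at all complex points or at none
(`AlgebraicityLocusFromMumfordVerdier`, `AlgebraicityLocusComplDichotomy`). The dichotomy follows
from the local topological triviality of the COMPLEMENT of `𝒵` over the generic part of `Y`
(`dichotomy_of_complTrivialisation`), which is proved here in three parts.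

**Part 1 — Ehresmann relative to a simple normal crossings boundary** (Voisin I §9.1.1 "Ehresmann
for pairs"; Dimca 1992 Ch. 1 (3.1)/(3.5)): for `g : X ⟶ B` proper between smooth separated
`ℂ`-schemes, an snc boundary `E` on `X` and an open `O ⊆ B` over which `g` and all the strata
`V(∑_{K∈T} K)`, `T ⊆ E`, are smooth, the complement of `E(ℂ)` in `g⁻¹(O)(ℂ)` is a locally
trivial fibration over `O(ℂ)` — at every point the snc data give the stratum through the point,
a lift of the point and local equations of the divisors (`exists_stratumData`), which feed the
adapted charts of `Motives.exists_adaptedChart` and the relative Ehresmann theorem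
`AlgebraicTopology.Homotopy.isLocallyTrivialFibration_compl_of_straightened`
(`isLocallyTrivialFibration_sncCompl`).

**Part 2 — generic local triviality of the complement of a closed subset in a smooth proper
family** (`exists_opens_isLocallyTrivialFibration_compl`): for `g : X ⟶ B` proper smooth over an
integral smooth `B` and `C ⊆ X` closed, over a dense open `O ⊆ B` the family
`{x ∈ X(ℂ) ∖ C(ℂ) | g x ∈ O} → O(ℂ)` is locally trivial: `X` is regular, so its irreducible
components are open, closed and disjoint; on a component `W ⊄ C` take an embedded log resolution
of `C ∩ W` (`Resolution.exists_logResolution_of_isClosed`, Hironaka/Kollár, PROVED in the tree),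
the dense open over which the resolution and all strata of the exceptional snc divisor are smooth
(`Resolution.HasSNC.exists_forall_smooth_strata`, characteristic `0`), and Part 1; glue the
finitely many clopen pieces (`IsLocallyTrivialFibration.of_isLocallyConstant`).

**Part 3 — the parameter-space form, the dichotomy input and the capstone**
(`isLocallyTrivialFibration_compl_generic`, `complTrivialisation_generic`,
`charlesSchnell_algebraicityLocus_iUnion_closed_of_mumford`,
`charlesSchnell_algebraicityLocus_iUnion_closed_holds`): base change to the regular part of
`Y_red` (smooth over `ℂ`), Part 2, transport along `(𝒳 ×_S B)(ℂ) ≃ {(x, β) | f x = h β}` and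
`B(ℂ) ↪ T(ℂ)`, path connected relative neighbourhoods (SGA1 XII 2.4), the dichotomy, and the
assembly of `AlgebraicityLocusFromMumfordVerdier` with Mumford's curve lemma — a theorem of the
tree (`Motives.mumford_smoothCurve_through_two_points_holds`).

Everything here is proved; no named fact is introduced; the named fact is DISCHARGED.

## References

* [CharlesSchnell2014Notes] F. Charles, C. Schnell, Notes on absolute Hodge classes (2014),
  Prop. 11.3.11 (proof).
* [VoisinHodgeII2003] C. Voisin, Hodge Theory and Complex Algebraic Geometry II (2003), §3.3.1,
  §7.3.2.
* [VoisinHodgeI2002] C. Voisin, Hodge Theory and Complex Algebraic Geometry I (2002), §9.1.1,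
  Thm. 9.3, Prop. 9.5.
* [Dimca1992] A. Dimca, Singularities and Topology of Hypersurfaces (1992), Ch. 1 (3.1), (3.5).
* [Kollar2007] J. Kollár, Lectures on Resolution of Singularities (2007), Thm. 3.35, Cor. 3.22.
* [Matsumura1987] H. Matsumura, Commutative Ring Theory (1986), Thm. 14.2, §30.
* [BierstoneGrigorievMilmanWlodarczyk2011] BGMW, arXiv:1206.3090, Def. 3.1.1.
* [MumfordAV1970] D. Mumford, Abelian Varieties (1970), §6, Lemma.
* [SGA1] A. Grothendieck, M. Raynaud, SGA 1, Exp. XII, Prop. 2.4, Prop. 3.1.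
* [Hartshorne1977] R. Hartshorne, Algebraic Geometry (1977), II.3 Thm. 3.3.
* [StacksProject] The Stacks Project, Tag 0357.
-/

noncomputable section

open CategoryTheory AlgebraicGeometry Limits Set Filter TopologicalSpace IsLocalRing
open MonoidalCategory CartesianMonoidalCategory
open _root_.Topology
open scoped Manifold ContDiff
open Literature.AlgebraicGeometry.Motives Literature.AlgebraicGeometry.Motives.ProjectiveSpace
open Literature.AlgebraicGeometry.Resolution Literature.AlgebraicTopology.Homotopy

universe u

namespace Literature.AlgebraicGeometry.HodgeTheory

/-! ## Part 1 — Ehresmann relative to a simple normal crossings boundary -/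

section Part1


/-! ### Independence modulo `𝔪²` of a part of a regular system of parameters -/

/-- If `z₁, …, z_r` is part of a regular system of parameters and `∑ cᵢ zᵢ ∈ 𝔪²`, then all
`cᵢ ∈ 𝔪` (extend to a full regular system of parameters and use Matsumura 14.2).
[cite: Matsumura1987, Thm. 14.2] -/
theorem IsRsopPart.mem_maximalIdeal_of_sum_mul_mem_sq {R : Type*} [CommRing R] [IsLocalRing R]
    {r : ℕ} {z : Fin r → R} (hz : IsRsopPart z) (c : Fin r → R)
    (hc : ∑ i, c i * z i ∈ (maximalIdeal R) ^ 2) (i : Fin r) : c i ∈ maximalIdeal R := by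
  haveI := hz.isRegularLocalRing
  obtain ⟨e, x, hd, hx, hxz⟩ := hz.exists_rsop
  let c' : Fin (r + e) → R := Fin.append c 0
  have hsum : ∑ k, c' k * x k = ∑ i, c i * z i := by
    rw [Fin.sum_univ_add]
    simp [c', hxz]
  have h := mem_maximalIdeal_of_sum_mul_rsop_mem_sq hd x hx c' (by rw [hsum]; exact hc)
    (Fin.castAdd e i)
  simpa [c'] using h

/-! ### The per-point stratum data -/

section Point

variable {X B : Motives.SchemeOver ℂ} (g : X ⟶ B) {E : List X.left.IdealSheafData}
  (O : B.left.Opens)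

/-- **Stratum data at a point.** Let `g : X ⟶ B` be a morphism of `ℂ`-schemes locally of finite
type, `E` an snc boundary on `X`, `O ⊆ B` open over which every stratum `V(∑_{K∈T} K) → B`
(`T ⊆ E`) is smooth, and `x` a complex point of `g⁻¹(O)`. Let `T` be the set of members of `E`
through `x` and `J = ∑_{D∈T} D`. Then: the closed immersion `ι : V(J) ∩ g⁻¹(O) → g⁻¹(O)` is
such that `ι ≫ g|_O = (V(J) → B)|_O` is smooth; `x` lifts to `V(J) ∩ g⁻¹(O)`; and on some affine
open `U₀ ∋ x` of `g⁻¹(O)` there are regular functions `w₁, …, w_r` (local equations of the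
divisors of `T`: sections representing the adapted regular parameters at `x`, spread out to
generators of the divisors on a neighbourhood) which vanish on `V(J)`, have germs at `x` linearly
independent modulo `𝔪_x²`, and cut out on `U₀` every member of `E` through `x` — while the
other members of `E` miss `x`. [cite: BierstoneGrigorievMilmanWlodarczyk2011, Def. 3.1.1]
[cite: Matsumura1987, Thm. 14.2] -/
theorem exists_stratumData [LocallyOfFiniteType X.hom] [LocallyOfFiniteType B.hom]
    (hE : HasSNC E)
    (hstrata : ∀ T : Finset X.left.IdealSheafData, (∀ K ∈ T, K ∈ E) →
      Smooth (((T.sup id).subschemeι ≫ g.left) ∣_ O))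
    (x : Motives.ComplexPoints (openSubschemeOver X (g.left ⁻¹ᵁ O))) :
    ∃ (Z : Motives.SchemeOver ℂ) (ι : Z ⟶ openSubschemeOver X (g.left ⁻¹ᵁ O))
      (_ : IsClosedImmersion ι.left) (_ : Smooth (ι ≫ restrictOverHom g O).left)
      (P' : Motives.ComplexPoints Z) (_ : AlgPoints.map ι P' = x)
      (U₀ : (openSubschemeOver X (g.left ⁻¹ᵁ O)).left.affineOpens)
      (hU₀ : x.pt ∈ (↑U₀ : (openSubschemeOver X (g.left ⁻¹ᵁ O)).left.Opens))
      (r : ℕ) (w : Fin r → Γ((openSubschemeOver X (g.left ⁻¹ᵁ O)).left, ↑U₀)),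
      (∀ i, ι.left.appLE ↑U₀ (ι.left ⁻¹ᵁ ↑U₀) le_rfl (w i) = 0) ∧
      (∀ b : Fin r → ℂ,
        ((openSubschemeOver X (g.left ⁻¹ᵁ O)).left.presheaf.germ ↑U₀ x.pt hU₀).hom
            (∑ i, Motives.SchemeOver.scalarRingHom (openSubschemeOver X (g.left ⁻¹ᵁ O)) ↑U₀ (b i) *
              w i) ∈
          maximalIdeal ((openSubschemeOver X (g.left ⁻¹ᵁ O)).left.presheaf.stalk x.pt) ^ 2 →
        b = 0) ∧
      ∀ D ∈ E, (g.left ⁻¹ᵁ O).ι x.pt ∉ D.support ∨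
        ∃ i, {y : (openSubschemeOver X (g.left ⁻¹ᵁ O)).left | (g.left ⁻¹ᵁ O).ι y ∈ D.support} ∩
            (↑U₀ : Set (openSubschemeOver X (g.left ⁻¹ᵁ O)).left) =
          (↑U₀ : Set (openSubschemeOver X (g.left ⁻¹ᵁ O)).left) \
            (openSubschemeOver X (g.left ⁻¹ᵁ O)).left.basicOpen (w i) := by
  classical
  -- notation
  let XO : Motives.SchemeOver ℂ := openSubschemeOver X (g.left ⁻¹ᵁ O)
  let jX : XO ⟶ X := openSubschemeOverι X (g.left ⁻¹ᵁ O)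
  haveI : IsOpenImmersion jX.left := inferInstanceAs (IsOpenImmersion (g.left ⁻¹ᵁ O).ι)
  haveI : IsLocallyNoetherian X.left := LocallyOfFiniteType.isLocallyNoetherian X.hom
  -- the point of `X` under `x` and the snc data there
  set ξ : X.left := (g.left ⁻¹ᵁ O).ι x.pt with hξ
  have hξO : ξ ∈ g.left ⁻¹ᵁ O := by rw [hξ, Scheme.Opens.ι_apply]; exact x.pt.2
  obtain ⟨hreg, u, hu, ⟨lab, hlab, hlabD⟩, -⟩ := hE ξ
  haveI := hreg
  haveI : IsDomain (X.left.presheaf.stalk ξ) := isDomain_of_isRegularLocalRing _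
  -- the divisors through `ξ`
  set T : Finset X.left.IdealSheafData := E.toFinset.filter fun D => ξ ∈ D.support with hT
  have hTE : ∀ K ∈ T, K ∈ E := fun K hK => List.mem_toFinset.1 (Finset.mem_filter.1 hK).1
  have hTξ : ∀ K ∈ T, ξ ∈ K.support := fun K hK => (Finset.mem_filter.1 hK).2
  have hTmem : ∀ D ∈ E, ξ ∈ D.support → D ∈ T := fun D hD hξD =>
    Finset.mem_filter.2 ⟨List.mem_toFinset.2 hD, hξD⟩
  set J : X.left.IdealSheafData := T.sup id with hJ
  have hξJ : ξ ∈ J.support := (mem_support_finsetSup_iff T ξ).2 hTξ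
  -- enumerate `T`
  set r : ℕ := Fintype.card ↥T with hr
  let σ : Fin r ≃ ↥T := (Fintype.equivFin ↥T).symm
  let Dof : Fin r → X.left.IdealSheafData := fun i => (σ i).1
  have hDofT : ∀ i, Dof i ∈ T := fun i => (σ i).2
  have hDofE : ∀ i, Dof i ∈ E := fun i => hTE _ (hDofT i)
  have hDofξ : ∀ i, ξ ∈ (Dof i).support := fun i => hTξ _ (hDofT i)
  have hDofinj : Function.Injective Dof := fun i j h =>
    σ.injective (Subtype.ext h)
  -- the adapted regular parameters of the divisors through `ξ`
  let lab' : Fin r → Fin (maximalIdeal (X.left.presheaf.stalk ξ)).spanFinrank :=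
    fun i => lab ⟨Dof i, hDofE i, hDofξ i⟩
  have hlab'inj : Function.Injective lab' := fun i j h => by
    have h1 := hlab h
    have h2 : Dof i = Dof j := congrArg (fun D : {D // D ∈ E ∧ ξ ∈ D.support} => D.1) h1
    exact hDofinj h2
  let z : Fin r → X.left.presheaf.stalk ξ := u ∘ lab'
  have hz : IsRsopPart z := isRsopPart_comp_of_rsop rfl u hu lab' hlab'inj
  have hzD : ∀ i, stalkIdeal (Dof i) ξ = Ideal.span {z i} := fun i => hlabD ⟨Dof i, hDofE i, hDofξ i⟩
  -- sections on an affine open `Ua ∋ ξ` inside `g⁻¹ O` representing the parameters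
  obtain ⟨Ua', hUa', hξUa, hUaO⟩ := exists_isAffineOpen_mem_and_subset hξO
  set Ua : X.left.affineOpens := ⟨Ua', hUa'⟩ with hUa
  obtain ⟨s, hs⟩ := exists_sections_associated Ua hξUa z
  have hzs : IsRsopPart fun i => (X.left.presheaf.germ ↑Ua ξ hξUa).hom (s i) := hz.of_associated hs
  have hsD : ∀ i, stalkIdeal (Dof i) ξ =
      Ideal.span {(X.left.presheaf.germ ↑Ua ξ hξUa).hom (s i)} := fun i => by
    rw [hzD i]
    exact Ideal.span_singleton_eq_span_singleton.2 (hs i)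
  -- each `s i` generates `Dof i` on a basic open neighbourhood of `ξ`
  have hgen : ∀ i, ∃ f : Γ(X.left, ↑Ua), ξ ∈ X.left.basicOpen f ∧
      Ideal.span {(X.left.presheaf.map (homOfLE (X.left.basicOpen_le f)).op).hom (s i)} =
        (Dof i).ideal (X.left.affineBasicOpen f) := by
    intro i
    have h1 : stalkIdeal (Dof i) ξ = Ideal.span (Set.range fun _ : Fin 1 =>
        (X.left.presheaf.germ ↑Ua ξ hξUa).hom (s i)) := by
      rw [hsD i, Set.range_const]
    have h2 : IsRsopPart fun _ : Fin 1 => (X.left.presheaf.germ ↑Ua ξ hξUa).hom (s i) :=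
      hzs.comp (fun _ : Fin 1 => i) fun a b _ => Subsingleton.elim a b
    obtain ⟨f, hξf, hspan, -⟩ := exists_basicOpen_span_eq_isQuasiRegular Ua hξUa (Dof i)
      (fun _ : Fin 1 => s i) h1 h2
    refine ⟨f, hξf, ?_⟩
    rw [← hspan, Set.range_const]
  choose f hξf hfspan using hgen
  -- a common affine open `U₁ ∋ ξ` inside all the `D(f i)`
  let V : X.left.Opens :=
    ⟨(⋂ i, (X.left.basicOpen (f i) : Set X.left)) ∩ (↑Ua : X.left.Opens),
      (isOpen_iInter_of_finite fun i => (X.left.basicOpen (f i)).isOpen).inter (Ua : X.left.Opens).isOpen⟩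
  have hξV : ξ ∈ V := ⟨Set.mem_iInter.2 hξf, hξUa⟩
  obtain ⟨U₁', hU₁', hξU₁, hU₁V⟩ := exists_isAffineOpen_mem_and_subset hξV
  set U₁ : X.left.affineOpens := ⟨U₁', hU₁'⟩ with hU₁
  have hU₁f : ∀ i, (↑U₁ : X.left.Opens) ≤ X.left.basicOpen (f i) := fun i y hy =>
    Set.mem_iInter.1 (hU₁V hy).1 i
  have hU₁Ua : (↑U₁ : X.left.Opens) ≤ ↑Ua := fun y hy => (hU₁V hy).2
  have hU₁O : (↑U₁ : X.left.Opens) ≤ g.left ⁻¹ᵁ O := fun y hy => hUaO (hU₁Ua hy)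
  -- the equations on `U₁`
  let t : Fin r → Γ(X.left, ↑U₁) := fun i => X.left.presheaf.map (homOfLE hU₁Ua).op (s i)
  have htspan : ∀ i, Ideal.span {t i} = (Dof i).ideal U₁ := by
    intro i
    have hle : U₁ ≤ X.left.affineBasicOpen (f i) := hU₁f i
    have h1 := (Dof i).map_ideal hle
    rw [← hfspan i] at h1
    erw [Ideal.map_span, Set.image_singleton] at h1
    rw [← h1]
    have ht : t i = (X.left.presheaf.map (homOfLE hle).op).hom
        ((X.left.presheaf.map (homOfLE (X.left.basicOpen_le (f i))).op).hom (s i)) := by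
      change X.left.presheaf.map _ (s i) = (X.left.presheaf.map _ ≫ X.left.presheaf.map _) (s i)
      rw [← Functor.map_comp]
      rfl
    rw [ht]
    rfl
  have htJ : ∀ i, t i ∈ J.ideal U₁ := fun i => by
    have hle : Dof i ≤ J := by
      rw [hJ]; exact Finset.le_sup (f := id) (hDofT i)
    exact (Scheme.IdealSheafData.le_def.1 hle U₁) ((htspan i).le (Ideal.mem_span_singleton_self _))
  have htgerm : ∀ i, (X.left.presheaf.germ ↑U₁ ξ hξU₁).hom (t i) =
      (X.left.presheaf.germ ↑Ua ξ hξUa).hom (s i) := fun i =>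
    TopCat.Presheaf.germ_res_apply X.left.presheaf (homOfLE hU₁Ua) ξ hξU₁ (s i)
  have htrsop : IsRsopPart fun i => (X.left.presheaf.germ ↑U₁ ξ hξU₁).hom (t i) := by
    have h : (fun i => (X.left.presheaf.germ ↑U₁ ξ hξU₁).hom (t i)) =
        fun i => (X.left.presheaf.germ ↑Ua ξ hξUa).hom (s i) := funext htgerm
    rw [h]; exact hzs
  -- supports on `U₁`: `supp (Dof i) ∩ U₁ = U₁ ∖ D(t i)`
  have hsuppU₁ : ∀ i (y : X.left), y ∈ (↑U₁ : X.left.Opens) →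
      (y ∈ (Dof i).support ↔ y ∉ X.left.basicOpen (t i)) := by
    intro i y hy
    have h := congrArg (y ∈ ·) (Scheme.IdealSheafData.coe_support_inter (Dof i) U₁)
    simp only [Set.mem_inter_iff, SetLike.mem_coe, eq_iff_iff] at h
    rw [← htspan i] at h
    constructor
    · intro hyD
      have h1 := (h.1 ⟨hyD, hy⟩).1
      rw [Scheme.mem_zeroLocus_iff] at h1
      exact h1 (t i) (Ideal.mem_span_singleton_self _)
    · intro hyt
      refine (h.2 ⟨?_, hy⟩).1
      rw [Scheme.mem_zeroLocus_iff]
      intro f' hf'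
      obtain ⟨a, rfl⟩ := Ideal.mem_span_singleton'.1 hf'
      rw [Scheme.basicOpen_mul]
      exact fun hmem => hyt hmem.2
  -- ### transfer to the open subscheme `g⁻¹(O)`
  have hU₁range : (↑U₁ : X.left.Opens) ≤ jX.left.opensRange := by
    have h : jX.left.opensRange = g.left ⁻¹ᵁ O := Scheme.Opens.opensRange_ι _
    rw [h]; exact hU₁O
  have hU₀aff : IsAffineOpen (jX.left ⁻¹ᵁ ↑U₁) := U₁.2.preimage_of_isOpenImmersion jX.left hU₁range
  let U₀ : XO.left.affineOpens := ⟨jX.left ⁻¹ᵁ ↑U₁, hU₀aff⟩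
  have hxU₀ : x.pt ∈ (↑U₀ : XO.left.Opens) := show jX.left x.pt ∈ (↑U₁ : X.left.Opens) from hξU₁
  let w : Fin r → Γ(XO.left, ↑U₀) := fun i => jX.left.app ↑U₁ (t i)
  -- ### the stratum `V(J) ∩ g⁻¹(O) → g⁻¹(O)`, smooth over `O`
  let ι₀ : ↑(J.subschemeι ⁻¹ᵁ (g.left ⁻¹ᵁ O)) ⟶ XO.left := J.subschemeι ∣_ (g.left ⁻¹ᵁ O)
  let Z : Motives.SchemeOver ℂ := Over.mk (ι₀ ≫ XO.hom)
  let ι : Z ⟶ XO := Over.homMk ι₀ rfl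
  haveI hιcl : IsClosedImmersion ι.left :=
    inferInstanceAs (IsClosedImmersion (J.subschemeι ∣_ (g.left ⁻¹ᵁ O)))
  have hcomp : (ι ≫ restrictOverHom g O).left = (J.subschemeι ≫ g.left) ∣_ O := by
    rw [Over.comp_left, restrictOverHom_left, morphismRestrict_comp]; rfl
  have hsmooth : Smooth (ι ≫ restrictOverHom g O).left := by rw [hcomp]; exact hstrata T hTE
  -- ### lift `x` to the stratum
  have hξrange : ξ ∈ Set.range J.subschemeι := by
    rw [Scheme.IdealSheafData.range_subschemeι]; exact hξJ
  obtain ⟨z₀, hz₀⟩ := hξrange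
  have hz₀O : z₀ ∈ J.subschemeι ⁻¹ᵁ (g.left ⁻¹ᵁ O) := by
    change J.subschemeι z₀ ∈ g.left ⁻¹ᵁ O
    rw [hz₀]; exact hξO
  have hxrange : x.pt ∈ Set.range ι.left := by
    refine ⟨⟨z₀, hz₀O⟩, Subtype.ext ?_⟩
    change ((J.subschemeι ∣_ (g.left ⁻¹ᵁ O)) ⟨z₀, hz₀O⟩).1 = (x.pt).1
    rw [morphismRestrict_base_coe]
    exact hz₀
  obtain ⟨P', hP'⟩ : x ∈ Set.range (AlgPoints.map ι : Motives.ComplexPoints Z → _) := by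
    rw [range_map_eq_setOf_pt_mem_range ι]; exact hxrange
  -- ### the equations vanish on the stratum
  have hker : ∀ i, J.subschemeι.app ↑U₁ (t i) = 0 := by
    intro i
    have hk : J.ideal U₁ = RingHom.ker (J.subschemeι.app ↑U₁).hom := by
      conv_lhs => rw [← Scheme.IdealSheafData.ker_subschemeι J]
      exact Scheme.Hom.ker_apply _ _
    have h := htJ i
    rw [hk] at h
    exact h
  have hfac₀ : ι₀ ≫ (g.left ⁻¹ᵁ O).ι = (J.subschemeι ⁻¹ᵁ (g.left ⁻¹ᵁ O)).ι ≫ J.subschemeι :=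
    morphismRestrict_ι _ _
  have hwZ₀ : ∀ i, ι₀.app ↑U₀ (w i) = 0 := by
    intro i
    have h3 : ι₀.app ↑U₀ ((g.left ⁻¹ᵁ O).ι.app ↑U₁ (t i)) = (ι₀ ≫ (g.left ⁻¹ᵁ O).ι).app ↑U₁ (t i) := by
      rw [Scheme.Hom.comp_app]; rfl
    have h0 : ((J.subschemeι ⁻¹ᵁ (g.left ⁻¹ᵁ O)).ι ≫ J.subschemeι).app ↑U₁ (t i) = 0 := by
      rw [Scheme.Hom.comp_app]
      erw [CommRingCat.comp_apply, hker, map_zero]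
    change ι₀.app ↑U₀ ((g.left ⁻¹ᵁ O).ι.app ↑U₁ (t i)) = 0
    rw [h3, Scheme.Hom.congr_app hfac₀ ↑U₁]
    erw [CommRingCat.comp_apply, h0, map_zero]
    rfl
  have hwZ : ∀ i, ι.left.appLE ↑U₀ (ι.left ⁻¹ᵁ ↑U₀) le_rfl (w i) = 0 := fun i => by
    rw [← Scheme.Hom.app_eq_appLE]
    exact hwZ₀ i
  -- ### independence of the germs modulo `𝔪²`, transported to the open subscheme
  have hwind : ∀ b : Fin r → ℂ,
      (XO.left.presheaf.germ ↑U₀ x.pt hxU₀).hom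
          (∑ i, Motives.SchemeOver.scalarRingHom XO ↑U₀ (b i) * w i) ∈
        maximalIdeal (XO.left.presheaf.stalk x.pt) ^ 2 → b = 0 := by
    intro b hb
    have hscal : ∀ c : ℂ, Motives.SchemeOver.scalarRingHom XO ↑U₀ c =
        jX.left.app ↑U₁ (Motives.SchemeOver.scalarRingHom X ↑U₁ c) := fun c => by
      rw [scalarRingHom_eq_appLE jX (V := ↑U₁) (U := ↑U₀) le_rfl c, ← Scheme.Hom.app_eq_appLE]
    have hsum : ∑ i, Motives.SchemeOver.scalarRingHom XO ↑U₀ (b i) * w i =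
        jX.left.app ↑U₁ (∑ i, Motives.SchemeOver.scalarRingHom X ↑U₁ (b i) * t i) := by
      rw [map_sum]
      refine Finset.sum_congr rfl fun i _ => ?_
      rw [map_mul, hscal]
    have hgerm : ∀ s' : Γ(X.left, ↑U₁), (XO.left.presheaf.germ ↑U₀ x.pt hxU₀).hom (jX.left.app ↑U₁ s') =
        (jX.left.stalkMap x.pt).hom ((X.left.presheaf.germ ↑U₁ ξ hξU₁).hom s') := fun s' =>
      (Scheme.Hom.germ_stalkMap_apply jX.left ↑U₁ x.pt hξU₁ s').symm
    rw [hsum, hgerm] at hb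
    -- the stalk map is an isomorphism of local rings
    let e : X.left.presheaf.stalk ξ ≃+* XO.left.presheaf.stalk x.pt :=
      (asIso (jX.left.stalkMap x.pt)).commRingCatIsoToRingEquiv
    have he : ∀ a, (jX.left.stalkMap x.pt).hom a = e a := fun a => rfl
    have hsymm : (maximalIdeal (XO.left.presheaf.stalk x.pt)).map e.symm.toRingHom ≤
        maximalIdeal (X.left.presheaf.stalk ξ) := by
      rw [Ideal.map_le_iff_le_comap]
      intro y hy
      rw [Ideal.mem_comap, IsLocalRing.mem_maximalIdeal, mem_nonunits_iff]
      intro hu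
      have h' := hu.map e
      have h2 : e (e.symm.toRingHom y) = y := e.apply_symm_apply y
      rw [h2] at h'
      exact (mem_nonunits_iff.1 ((IsLocalRing.mem_maximalIdeal _).1 hy)) h'
    have hmem : (X.left.presheaf.germ ↑U₁ ξ hξU₁).hom
        (∑ i, Motives.SchemeOver.scalarRingHom X ↑U₁ (b i) * t i) ∈
          maximalIdeal (X.left.presheaf.stalk ξ) ^ 2 := by
      rw [he] at hb
      have h1 := Ideal.mem_map_of_mem e.symm.toRingHom hb
      have h2 : ∀ a, e.symm.toRingHom (e a) = a := fun a => e.symm_apply_apply a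
      rw [Ideal.map_pow, h2] at h1
      exact Ideal.pow_right_mono hsymm 2 h1
    rw [map_sum] at hmem
    simp only [map_mul] at hmem
    have hcoef := IsRsopPart.mem_maximalIdeal_of_sum_mul_mem_sq htrsop _ hmem
    funext i
    by_contra hbi
    have hu : IsUnit ((X.left.presheaf.germ ↑U₁ ξ hξU₁).hom
        (Motives.SchemeOver.scalarRingHom X ↑U₁ (b i))) :=
      ((isUnit_iff_ne_zero.2 hbi).map _).map _
    exact (mem_nonunits_iff.1 ((IsLocalRing.mem_maximalIdeal _).1 (hcoef i))) hu
  -- ### assemble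
  refine ⟨Z, ι, hιcl, hsmooth, P', hP', U₀, hxU₀, r, w, hwZ, hwind, fun D hD => ?_⟩
  by_cases hξD : ξ ∈ D.support
  · right
    have hDT : D ∈ T := hTmem D hD hξD
    let i : Fin r := σ.symm ⟨D, hDT⟩
    have hDi : Dof i = D := by
      change (σ (σ.symm ⟨D, hDT⟩)).1 = D
      rw [Equiv.apply_symm_apply]
    have hbasic : jX.left ⁻¹ᵁ X.left.basicOpen (t i) = XO.left.basicOpen (w i) :=
      Scheme.preimage_basicOpen jX.left (t i)
    refine ⟨i, Set.ext fun y => ?_⟩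
    have key : y ∈ (↑U₀ : XO.left.Opens) → (jX.left y ∈ D.support ↔ y ∉ XO.left.basicOpen (w i)) := by
      intro hyU
      have hy1 : jX.left y ∈ (↑U₁ : X.left.Opens) := hyU
      rw [← hDi, hsuppU₁ i (jX.left y) hy1, ← hbasic]
      rfl
    simp only [Set.mem_inter_iff, Set.mem_setOf_eq, Set.mem_sdiff, SetLike.mem_coe]
    constructor
    · rintro ⟨hyD, hyU⟩
      exact ⟨hyU, (key hyU).1 hyD⟩
    · rintro ⟨hyU, hyw⟩
      exact ⟨(key hyU).2 hyw, hyU⟩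
  · left
    exact hξD

end Point

/-! ### The complement of the boundary is a locally trivial fibration over the good part of the base -/

section Main

variable {X B : Motives.SchemeOver ℂ} (g : X ⟶ B) {E : List X.left.IdealSheafData}
  (O : B.left.Opens)

/-- **Ehresmann relative to an snc boundary.** Let `g : X ⟶ B` be a proper morphism between
separated `ℂ`-schemes smooth over `ℂ` (relative dimensions `N`, `d`) and locally of finite type,
with second countable complex points; let `E` be an snc boundary on `X` and `O ⊆ B` an open over
which `g` and every stratum `V(∑_{K∈T} K) → B` (`T ⊆ E`) are smooth. Then the complement of the
boundary in `g⁻¹(O)(ℂ)` is a locally trivial fibration over `O(ℂ)` (for `g(ℂ)`): at every point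
the data of `exists_stratumData` feed `Motives.exists_adaptedChart`, producing the adapted charts
required by the relative Ehresmann theorem
`AlgebraicTopology.Homotopy.isLocallyTrivialFibration_compl_of_straightened` for the proper
submersion `g(ℂ) : g⁻¹(O)(ℂ) → O(ℂ)` (`ComplexPoints.contMDiff_map`, `surjective_mfderiv_map`,
`AlgPoints.isProperMap_map`) and the closed sets `D(ℂ)`, `D ∈ E`.
[cite: VoisinHodgeI2002, §9.1.1 and Thm. 9.3] [cite: Dimca1992, Ch. 1 Prop. (3.1), Thm. (3.5)]
[cite: CharlesSchnell2014Notes, Prop. 11.3.11 (proof)] -/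
theorem isLocallyTrivialFibration_sncCompl {N d : ℕ} [LocallyOfFiniteType X.hom]
    [SmoothOfRelativeDimension N X.hom] [IsSeparated X.hom] [LocallyOfFiniteType B.hom]
    [SmoothOfRelativeDimension d B.hom] [IsSeparated B.hom]
    [SecondCountableTopology (Motives.ComplexPoints X)]
    [SecondCountableTopology (Motives.ComplexPoints B)] [IsProper g.left] (hE : HasSNC E)
    (hgO : Smooth (g.left ∣_ O))
    (hstrata : ∀ T : Finset X.left.IdealSheafData, (∀ K ∈ T, K ∈ E) →
      Smooth (((T.sup id).subschemeι ≫ g.left) ∣_ O)) :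
    IsLocallyTrivialFibration
      (fun x : {x : Motives.ComplexPoints (openSubschemeOver X (g.left ⁻¹ᵁ O)) //
          ∀ D : {D // D ∈ E}, (g.left ⁻¹ᵁ O).ι x.pt ∉ D.1.support} =>
        AlgPoints.map (restrictOverHom g O) x.1) := by
  classical
  let XO : Motives.SchemeOver ℂ := openSubschemeOver X (g.left ⁻¹ᵁ O)
  let BO : Motives.SchemeOver ℂ := openSubschemeOver B O
  let gO : XO ⟶ BO := restrictOverHom g O
  let jX : XO ⟶ X := openSubschemeOverι X (g.left ⁻¹ᵁ O)
  let jB : BO ⟶ B := openSubschemeOverι B O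
  -- instances on the restricted family
  haveI : IsOpenImmersion jX.left := inferInstanceAs (IsOpenImmersion (g.left ⁻¹ᵁ O).ι)
  haveI : IsOpenImmersion jB.left := inferInstanceAs (IsOpenImmersion O.ι)
  haveI : LocallyOfFiniteType BO.hom := inferInstanceAs (LocallyOfFiniteType (O.ι ≫ B.hom))
  haveI : SmoothOfRelativeDimension d BO.hom := by
    have h : SmoothOfRelativeDimension (0 + d) (O.ι ≫ B.hom) := inferInstance
    rw [Nat.zero_add] at h
    exact h
  haveI : LocallyOfFiniteType XO.hom :=
    inferInstanceAs (LocallyOfFiniteType ((g.left ⁻¹ᵁ O).ι ≫ X.hom))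
  haveI : SmoothOfRelativeDimension N XO.hom := by
    have h : SmoothOfRelativeDimension (0 + N) ((g.left ⁻¹ᵁ O).ι ≫ X.hom) := inferInstance
    rw [Nat.zero_add] at h
    exact h
  haveI : IsSeparated BO.hom := inferInstanceAs (IsSeparated (O.ι ≫ B.hom))
  haveI : IsSeparated XO.hom := inferInstanceAs (IsSeparated ((g.left ⁻¹ᵁ O).ι ≫ X.hom))
  haveI : IsProper gO.left := inferInstanceAs (IsProper (g.left ∣_ O))
  haveI : Smooth gO.left := hgO
  have hjXe : IsOpenEmbedding (AlgPoints.map jX : Motives.ComplexPoints XO → Motives.ComplexPoints X) :=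
    AlgPoints.isOpenEmbedding_map_holds jX
  have hjBe : IsOpenEmbedding (AlgPoints.map jB : Motives.ComplexPoints BO → Motives.ComplexPoints B) :=
    AlgPoints.isOpenEmbedding_map_holds jB
  haveI : SecondCountableTopology (Motives.ComplexPoints XO) :=
    hjXe.isEmbedding.secondCountableTopology
  haveI : SecondCountableTopology (Motives.ComplexPoints BO) :=
    hjBe.isEmbedding.secondCountableTopology
  haveI : T2Space (Motives.ComplexPoints XO) := ComplexPoints.t2Space_of_isSeparated XO
  haveI : T2Space (Motives.ComplexPoints BO) := ComplexPoints.t2Space_of_isSeparated BO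
  letI := ComplexPoints.chartedSpace XO N
  letI := ComplexPoints.chartedSpace BO d
  haveI := ComplexPoints.isManifold_real XO N
  haveI := ComplexPoints.isManifold_real BO d
  -- the closed sets `D(ℂ) ∩ g⁻¹(O)(ℂ)`
  have hDc : ∀ D : {D // D ∈ E},
      IsClosed {x : Motives.ComplexPoints XO | (g.left ⁻¹ᵁ O).ι x.pt ∈ D.1.support} := by
    intro D
    have hopen : IsOpen {x : Motives.ComplexPoints XO |
        x.pt ∈ (⟨((g.left ⁻¹ᵁ O).ι ⁻¹' (D.1.support : Set X.left))ᶜ,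
          (D.1.support.isClosed.preimage (g.left ⁻¹ᵁ O).ι.continuous).isOpen_compl⟩ :
            XO.left.Opens)} := AlgPoints.isOpen_setOf_pt_mem _
    have heq : {x : Motives.ComplexPoints XO | (g.left ⁻¹ᵁ O).ι x.pt ∈ D.1.support} =
        {x : Motives.ComplexPoints XO | x.pt ∈ (⟨((g.left ⁻¹ᵁ O).ι ⁻¹' (D.1.support : Set X.left))ᶜ,
          (D.1.support.isClosed.preimage (g.left ⁻¹ᵁ O).ι.continuous).isOpen_compl⟩ :
            XO.left.Opens)}ᶜ := by
      ext x
      simp only [Set.mem_setOf_eq, Set.mem_compl_iff, Opens.mem_mk, Set.mem_preimage,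
        SetLike.mem_coe, not_not]
    rw [heq]
    exact hopen.isClosed_compl
  -- relative Ehresmann, with the adapted charts
  refine isLocallyTrivialFibration_compl_of_straightened (2 * N) (2 * d)
    (f := (AlgPoints.map gO : Motives.ComplexPoints XO → Motives.ComplexPoints BO))
    (ComplexPoints.contMDiff_map gO) (AlgPoints.isProperMap_map gO)
    (ComplexPoints.surjective_mfderiv_map gO)
    (fun D : {D // D ∈ E} => {x : Motives.ComplexPoints XO | (g.left ⁻¹ᵁ O).ι x.pt ∈ D.1.support})
    hDc (F'' := Fin (N - d) → ℂ) fun x => ?_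
  obtain ⟨Z, ι, hιcl, hsmooth, P', hP', U₀, hU₀, r, w, hwZ, hwind, hSw⟩ :=
    exists_stratumData g O hE hstrata x
  haveI := hιcl
  haveI : Smooth (ι ≫ gO).left := hsmooth
  haveI : LocallyOfFinitePresentation (ι ≫ gO).left := inferInstance
  have hsm : P'.pt ∈ (ι ≫ gO).left.smoothLocus := by
    rw [Scheme.Hom.smoothLocus_eq_top]; trivial
  obtain ⟨φ, hxφ, hφ, hφs, hsrc, hfst, hstraight⟩ := exists_adaptedChart (n := N) (m := d) gO x ι P'
    hP' hsm U₀ hU₀ w hwZ hwind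
    (S := fun D : {D // D ∈ E} => {y : XO.left | (g.left ⁻¹ᵁ O).ι y ∈ D.1.support})
    (fun D => D.1.support.isClosed.preimage (g.left ⁻¹ᵁ O).ι.continuous)
    (fun D => hSw D.1 D.2)
  exact ⟨φ, hxφ, hφ, hφs, hsrc, hfst, hstraight⟩

end Main




end Part1

/-! ## Part 2 — generic local triviality of the complement of a closed subset -/

section Part2


/-! ### Topological helpers -/

/-- A map with empty total space is a locally trivial fibration (empty fibres). [folklore] -/
theorem IsLocallyTrivialFibration.of_isEmpty {E B : Type*} [TopologicalSpace E]
    [TopologicalSpace B] [IsEmpty E] (f : E → B) : IsLocallyTrivialFibration f := by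
  intro b
  refine ⟨Set.univ, isOpen_univ, trivial, ?_⟩
  haveI : IsEmpty (↥(Set.univ : Set B) × ↥(f ⁻¹' {b})) := by
    rw [isEmpty_prod]
    exact Or.inr inferInstance
  refine ⟨{ toEquiv := Equiv.equivOfIsEmpty _ _,
            continuous_toFun := continuous_of_discreteTopology,
            continuous_invFun := continuous_of_discreteTopology }, fun x => isEmptyElim x⟩

/-- Two topological embeddings into the same space with the same range have homeomorphic
sources, compatibly with the embeddings. [folklore] -/
theorem exists_homeomorph_of_range_eq {α β γ : Type*} [TopologicalSpace α] [TopologicalSpace β]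
    [TopologicalSpace γ] {i : α → γ} {j : β → γ} (hi : IsEmbedding i) (hj : IsEmbedding j)
    (h : Set.range i = Set.range j) : ∃ e : α ≃ₜ β, ∀ a, j (e a) = i a := by
  refine ⟨(hi.toHomeomorph.trans (Homeomorph.setCongr h)).trans hj.toHomeomorph.symm, fun a => ?_⟩
  have hmem : i a ∈ Set.range j := h ▸ Set.mem_range_self a
  obtain ⟨b, hb⟩ := hmem
  have h1 : ((hi.toHomeomorph.trans (Homeomorph.setCongr h)) a : γ) = i a := rfl
  have h2 : (hi.toHomeomorph.trans (Homeomorph.setCongr h)) a = ⟨j b, Set.mem_range_self b⟩ :=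
    Subtype.ext (h1.trans hb.symm)
  rw [Homeomorph.trans_apply, h2, hj.toHomeomorph_symm_apply, hb]

/-! ### Function fields of `ℂ`-schemes have characteristic zero -/

/-- The function field of an integral `ℂ`-scheme has characteristic `0` (it contains `ℂ`).
[folklore] -/
theorem charZero_functionField (B : Motives.SchemeOver ℂ) [IsIntegral B.left] :
    CharZero B.left.functionField := by
  let φ : ℂ →+* B.left.functionField :=
    (B.left.presheaf.germ ⊤ (genericPoint B.left) trivial).hom.comp
      (Motives.SchemeOver.scalarRingHom B ⊤)
  exact charZero_of_injective_ringHom φ.injective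

/-! ### Complex points over an open over which a morphism is an isomorphism -/

section IsoLocus

variable {X' X : Motives.SchemeOver ℂ} (πr : X' ⟶ X) (U : X.left.Opens)

/-- If `π : X' ⟶ X` restricts to an isomorphism over the open `U ⊆ X`, then `π(ℂ)` maps the
complex points over `π⁻¹U` homeomorphically onto the complex points over `U`: precisely, the map
`{x' | x' ∈ π⁻¹U} → X(ℂ)` is an embedding with range `{x | x ∈ U}`. (The restriction
`π⁻¹U ⟶ U` is an isomorphism of `ℂ`-schemes, hence a homeomorphism on complex points, and the
open immersions `π⁻¹U ↪ X'`, `U ↪ X` are open embeddings of complex points.) [folklore] -/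
theorem isEmbedding_map_of_isIso_morphismRestrict [IsIso (πr.left ∣_ U)] :
    IsEmbedding (fun x' : {x' : Motives.ComplexPoints X' // x'.pt ∈ πr.left ⁻¹ᵁ U} =>
      (AlgPoints.map πr x'.1 : Motives.ComplexPoints X)) ∧
    Set.range (fun x' : {x' : Motives.ComplexPoints X' // x'.pt ∈ πr.left ⁻¹ᵁ U} =>
      (AlgPoints.map πr x'.1 : Motives.ComplexPoints X)) = {x | x.pt ∈ U} := by
  let XV : Motives.SchemeOver ℂ := openSubschemeOver X' (πr.left ⁻¹ᵁ U)
  let XU : Motives.SchemeOver ℂ := openSubschemeOver X U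
  let r : XV ⟶ XU := restrictOverHom πr U
  let jV : XV ⟶ X' := openSubschemeOverι X' (πr.left ⁻¹ᵁ U)
  let jU : XU ⟶ X := openSubschemeOverι X U
  haveI : IsOpenImmersion jV.left := inferInstanceAs (IsOpenImmersion (πr.left ⁻¹ᵁ U).ι)
  haveI : IsOpenImmersion jU.left := inferInstanceAs (IsOpenImmersion U.ι)
  haveI : IsIso r.left := inferInstanceAs (IsIso (πr.left ∣_ U))
  -- the inverse of `r` over `ℂ`
  let rinv : XU ⟶ XV := Over.homMk (inv r.left) (by
    rw [← cancel_epi r.left, IsIso.hom_inv_id_assoc]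
    exact (Over.w r).symm)
  have hrr : ∀ v : Motives.ComplexPoints XV, AlgPoints.map rinv (AlgPoints.map r v) = v := fun v => by
    rw [← AlgPoints.map_comp_apply r rinv v]
    have h : r ≫ rinv = 𝟙 XV := by
      ext1
      rw [Over.comp_left, Over.id_left]
      exact IsIso.hom_inv_id r.left
    rw [h, AlgPoints.map_id_apply]
  have hrr' : ∀ u : Motives.ComplexPoints XU, AlgPoints.map r (AlgPoints.map rinv u) = u := fun u => by
    rw [← AlgPoints.map_comp_apply rinv r u]
    have h : rinv ≫ r = 𝟙 XU := by
      ext1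
      rw [Over.comp_left, Over.id_left]
      exact IsIso.inv_hom_id r.left
    rw [h, AlgPoints.map_id_apply]
  let ρ : Motives.ComplexPoints XV ≃ₜ Motives.ComplexPoints XU :=
    { toFun := AlgPoints.map r
      invFun := AlgPoints.map rinv
      left_inv := hrr
      right_inv := hrr'
      continuous_toFun := AlgPoints.continuous_map r
      continuous_invFun := AlgPoints.continuous_map rinv }
  -- the open embeddings and their ranges
  have hjVe : IsOpenEmbedding (AlgPoints.map jV : Motives.ComplexPoints XV → Motives.ComplexPoints X') :=
    AlgPoints.isOpenEmbedding_map_holds jV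
  have hjUe : IsOpenEmbedding (AlgPoints.map jU : Motives.ComplexPoints XU → Motives.ComplexPoints X) :=
    AlgPoints.isOpenEmbedding_map_holds jU
  have hrV : Set.range (AlgPoints.map jV : Motives.ComplexPoints XV → Motives.ComplexPoints X') =
      {x' | x'.pt ∈ πr.left ⁻¹ᵁ U} := by
    rw [AlgPoints.range_map_of_isOpenImmersion_holds jV]
    ext Q
    change Q.pt ∈ (πr.left ⁻¹ᵁ U).ι.opensRange ↔ Q.pt ∈ πr.left ⁻¹ᵁ U
    rw [Scheme.Opens.opensRange_ι]
  have hrU : Set.range (AlgPoints.map jU : Motives.ComplexPoints XU → Motives.ComplexPoints X) =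
      {x | x.pt ∈ U} := by
    rw [AlgPoints.range_map_of_isOpenImmersion_holds jU]
    ext Q
    change Q.pt ∈ U.ι.opensRange ↔ Q.pt ∈ U
    rw [Scheme.Opens.opensRange_ι]
  have hcomm : ∀ v : Motives.ComplexPoints XV,
      AlgPoints.map πr (AlgPoints.map jV v) = AlgPoints.map jU (AlgPoints.map r v) := fun v => by
    rw [← AlgPoints.map_comp_apply jV πr v, ← AlgPoints.map_comp_apply r jU v,
      restrictOverHom_comp_openSubschemeOverι]
  -- the homeomorphism `{x' | x' ∈ π⁻¹U} ≃ₜ XV(ℂ)`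
  obtain ⟨e, he⟩ := exists_homeomorph_of_range_eq
    (i := (Subtype.val : {x' : Motives.ComplexPoints X' // x'.pt ∈ πr.left ⁻¹ᵁ U} → _))
    IsEmbedding.subtypeVal hjVe.isEmbedding (by rw [hrV]; exact Subtype.range_coe)
  have hfac : (fun x' : {x' : Motives.ComplexPoints X' // x'.pt ∈ πr.left ⁻¹ᵁ U} =>
      (AlgPoints.map πr x'.1 : Motives.ComplexPoints X)) = AlgPoints.map jU ∘ ρ ∘ e := by
    funext x'
    change AlgPoints.map πr x'.1 = AlgPoints.map jU (AlgPoints.map r (e x'))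
    rw [← hcomm, he]
  refine ⟨?_, ?_⟩
  · rw [hfac]
    exact hjUe.isEmbedding.comp (ρ.isEmbedding.comp e.isEmbedding)
  · rw [hfac, Set.range_comp, Set.range_comp, e.surjective.range_eq, Set.image_univ,
      ρ.surjective.range_eq, Set.image_univ, hrU]

end IsoLocus

/-! ### One irreducible clopen piece -/

section Piece

variable {X B : Motives.SchemeOver ℂ} (g : X ⟶ B) {n d : ℕ}

/-- **Generic local triviality of the complement, for an irreducible open-and-closed piece.**
Let `g : X ⟶ B` be proper and smooth of relative dimension `n`, `B` an integral separated
`ℂ`-scheme of finite type, smooth over `ℂ` of relative dimension `d`; let `W ⊆ X` be open,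
closed and irreducible, and `C ⊆ X` closed with `W ⊄ C`. Then there is an open `O ∋ η_B` such
that `{x ∈ X(ℂ) | x ∈ W, x ∉ C, g(x) ∈ O} → O(ℂ)` is a locally trivial fibration: `W` (open
subscheme) is integral, regular (smooth over `ℂ`) and proper over `B`; take an embedded log
resolution `π : X' → W` of `C ∩ W` (`Resolution.exists_logResolution_of_isClosed`), the dense
open `O` over which `X' → B` and all strata of the snc boundary `E = π⁻¹(C ∩ W)` are smooth
(`Resolution.HasSNC.exists_forall_smooth_strata`, characteristic `0`), and Ehresmann relative to
`E` (`isLocallyTrivialFibration_sncCompl`); finally `π(ℂ)` identifies the complement of `E(ℂ)`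
over `O` with `{x ∈ W(ℂ) ∖ C(ℂ) | g(x) ∈ O}` (`isEmbedding_map_of_isIso_morphismRestrict`).
[cite: VoisinHodgeI2002, §9.1.1, Thm. 9.3] [cite: Kollar2007, Thm. 3.35]
[cite: CharlesSchnell2014Notes, Prop. 11.3.11 (proof)] -/
theorem exists_opens_isLocallyTrivialFibration_compl_of_isIrreducible [IsProper g.left]
    [SmoothOfRelativeDimension n g.left] [IsIntegral B.left] [LocallyOfFiniteType B.hom]
    [SmoothOfRelativeDimension d B.hom] [IsSeparated B.hom] [CompactSpace B.left]
    (W : X.left.Opens) (hWc : IsClosed (W : Set X.left)) (hWirr : IsIrreducible (W : Set X.left))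
    (C : Set X.left) (hC : IsClosed C) (hCW : ¬ (W : Set X.left) ⊆ C) :
    ∃ O : B.left.Opens, genericPoint B.left ∈ O ∧
      IsLocallyTrivialFibration
        (fun x : {x : Motives.ComplexPoints X // x.pt ∈ W ∧ x.pt ∉ C ∧ g.left x.pt ∈ O} =>
          (⟨AlgPoints.map g x.1, x.2.2.2⟩ : {β : Motives.ComplexPoints B // β.pt ∈ O})) := by
  classical
  -- ### standing instances on `X` and `B`
  haveI : LocallyOfFiniteType X.hom := by rw [← Over.w g]; infer_instance
  haveI : IsSeparated X.hom := by rw [← Over.w g]; infer_instance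
  haveI : SmoothOfRelativeDimension (n + d) X.hom := ComplexPoints.smoothOfRelativeDimension_hom_of_hom g n d
  haveI : CompactSpace X.left := QuasiCompact.compactSpace_of_compactSpace g.left
  haveI : IsLocallyNoetherian X.left := LocallyOfFiniteType.isLocallyNoetherian X.hom
  haveI : IsLocallyNoetherian B.left := LocallyOfFiniteType.isLocallyNoetherian B.hom
  haveI : IsNoetherian X.left := {}
  have hXreg : Scheme.IsRegular X.left := fun x =>
    isRegularLocalRing_stalk_of_smoothOfRelativeDimension X.hom (n + d) x
  haveI : IsReduced X.left := hXreg.isReduced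
  haveI : SecondCountableTopology (Motives.ComplexPoints B) :=
    ComplexPoints.secondCountableTopology_of_compactSpace_holds B
  haveI : CharZero B.left.functionField := charZero_functionField B
  -- ### the piece `W` as an integral regular proper `B`-scheme
  let Xc : Motives.SchemeOver ℂ := openSubschemeOver X W
  let jc : Xc ⟶ X := openSubschemeOverι X W
  let gc : Xc ⟶ B := jc ≫ g
  haveI : IsOpenImmersion jc.left := inferInstanceAs (IsOpenImmersion W.ι)
  haveI hWci : IsClosedImmersion W.ι :=
    IsClosedImmersion.of_isPreimmersion _ (by rw [Scheme.Opens.range_ι]; exact hWc)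
  haveI : IsClosedImmersion jc.left := hWci
  haveI : IsProper gc.left := by
    change IsProper (W.ι ≫ g.left)
    infer_instance
  haveI : LocallyOfFiniteType Xc.hom := inferInstanceAs (LocallyOfFiniteType (W.ι ≫ X.hom))
  haveI : IsSeparated Xc.hom := inferInstanceAs (IsSeparated (W.ι ≫ X.hom))
  haveI hWirrS : IrreducibleSpace (W : Scheme) := Subtype.irreducibleSpace hWirr
  haveI hWred : IsReduced (W : Scheme) :=
    @isReduced_of_isOpenImmersion (W : Scheme) X.left W.ι inferInstance inferInstance
  haveI hWint : IsIntegral (W : Scheme) := isIntegral_of_irreducibleSpace_of_isReduced _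
  haveI : IrreducibleSpace Xc.left := hWirrS
  haveI : IsIntegral Xc.left := hWint
  have hcreg : Scheme.IsRegular Xc.left := fun x => by
    haveI : IsRegularLocalRing (X.left.presheaf.stalk (W.ι x)) := hXreg _
    exact IsRegularLocalRing.of_ringEquiv (asIso (W.ι.stalkMap x)).commRingCatIsoToRingEquiv
  -- the closed subset `Cc = C ∩ W` of `W`
  let Cc : Set Xc.left := (W.ι : Xc.left → X.left) ⁻¹' C
  have hCc : IsClosed Cc := hC.preimage W.ι.continuous
  have hCcne : Cc ≠ Set.univ := by
    intro h
    apply hCW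
    intro w hw
    have hmem : (⟨w, hw⟩ : Xc.left) ∈ Cc := h ▸ Set.mem_univ _
    change W.ι ⟨w, hw⟩ ∈ C at hmem
    rwa [Scheme.Opens.ι_apply] at hmem
  -- ### the log resolution of `Cc`
  haveI hWcpt : CompactSpace (W : Scheme) := isCompact_iff_compactSpace.mp hWc.isCompact
  haveI : QuasiCompact (W.ι ≫ X.hom) := HasAffineProperty.iff_of_isAffine.mpr hWcpt
  obtain ⟨X', πr, E, hπr, hint, hreg', hiso, hE, hpre⟩ :=
    exists_logResolution_of_isClosed (k := ℂ) (W.ι ≫ X.hom) hcreg hCc hCcne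
  haveI := hπr
  haveI := hint
  haveI := hiso
  -- `X'` over `ℂ` and over `B`
  let g'l : X' ⟶ B.left := πr ≫ W.ι ≫ g.left
  let X'O : Motives.SchemeOver ℂ := Over.mk (πr ≫ Xc.hom)
  let πrO : X'O ⟶ Xc := Over.homMk πr rfl
  let g' : X'O ⟶ B := πrO ≫ gc
  haveI : IsProper πrO.left := hπr
  haveI : IsProper g'l := by
    change IsProper (πr ≫ W.ι ≫ g.left)
    infer_instance
  haveI : IsProper g'.left := inferInstanceAs (IsProper (πr ≫ W.ι ≫ g.left))
  have hltX' : LocallyOfFiniteType (πr ≫ W.ι ≫ X.hom) := inferInstance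
  haveI : LocallyOfFiniteType X'O.hom := hltX'
  haveI : IsSeparated X'O.hom := inferInstanceAs (IsSeparated (πr ≫ W.ι ≫ X.hom))
  haveI : CompactSpace X' := QuasiCompact.compactSpace_of_compactSpace πr
  haveI : CompactSpace X'O.left := inferInstanceAs (CompactSpace X')
  haveI : IsLocallyNoetherian X' := LocallyOfFiniteType.isLocallyNoetherian (πr ≫ W.ι ≫ X.hom)
  haveI : Smooth X'O.hom :=
    @smooth_of_isRegular_of_perfectField ℂ _ _ X' (πr ≫ W.ι ≫ X.hom) hltX' hreg'
  haveI : IrreducibleSpace X'O.left := inferInstanceAs (IrreducibleSpace X')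
  obtain ⟨N', hN'⟩ := exists_smoothOfRelativeDimension_of_smooth X'O.hom
  haveI := hN'
  haveI : SecondCountableTopology (Motives.ComplexPoints X'O) :=
    ComplexPoints.secondCountableTopology_of_compactSpace_holds X'O
  -- ### generic smoothness of `X' → B` and of the strata of `E`
  haveI : LocallyOfFinitePresentation g'l :=
    locallyOfFinitePresentation_of_isLocallyNoetherian g'l
  haveI : ∀ T : Finset X'.IdealSheafData,
      LocallyOfFinitePresentation ((T.sup id).subschemeι ≫ g'l) := fun T =>
    locallyOfFinitePresentation_of_isLocallyNoetherian _
  obtain ⟨O, hηO, hgO, hstrata⟩ := hE.exists_forall_smooth_strata g'l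
  -- ### Ehresmann relative to the snc boundary
  have hF := isLocallyTrivialFibration_sncCompl (N := N') (d := d) g' O hE hgO hstrata
  refine ⟨O, hηO, ?_⟩
  -- ### identification of the complement of `E(ℂ)` over `O` with `{x ∈ W(ℂ) ∖ C(ℂ) | g x ∈ O}`
  let X'V : Motives.SchemeOver ℂ := openSubschemeOver X'O (g'.left ⁻¹ᵁ O)
  let jV : X'V ⟶ X'O := openSubschemeOverι X'O (g'.left ⁻¹ᵁ O)
  let BO : Motives.SchemeOver ℂ := openSubschemeOver B O
  let jO : BO ⟶ B := openSubschemeOverι B O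
  haveI : IsOpenImmersion jV.left := inferInstanceAs (IsOpenImmersion (g'.left ⁻¹ᵁ O).ι)
  haveI : IsOpenImmersion jO.left := inferInstanceAs (IsOpenImmersion O.ι)
  -- the source of `hF` and its map to `X(ℂ)`
  let Src := {x' : Motives.ComplexPoints X'V // ∀ D : {D // D ∈ E}, (g'.left ⁻¹ᵁ O).ι x'.pt ∉ D.1.support}
  let Tgt : Set (Motives.ComplexPoints X) := {x | x.pt ∈ W ∧ x.pt ∉ C ∧ g.left x.pt ∈ O}
  -- membership in the boundary versus membership in `C`
  have hbdry : ∀ z : X', (∀ D : {D // D ∈ E}, z ∉ D.1.support) ↔ W.ι (πr z) ∉ C := by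
    intro z
    have h := Set.ext_iff.1 hpre z
    simp only [Set.mem_preimage, Set.mem_iUnion, exists_prop] at h
    constructor
    · intro hz hC'
      obtain ⟨D, hD, hzD⟩ := h.1 hC'
      exact hz ⟨D, hD⟩ hzD
    · intro hz D hzD
      exact hz (h.2 ⟨D.1, D.2, hzD⟩)
  -- `π(ℂ)` is an embedding off the boundary
  let U : Xc.left.Opens := ⟨Ccᶜ, hCc.isOpen_compl⟩
  haveI : IsIso (πrO.left ∣_ U) := hiso
  obtain ⟨hπre, hπrr⟩ := isEmbedding_map_of_isIso_morphismRestrict πrO U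
  -- the map `Src → X(ℂ)`
  let F : Src → Motives.ComplexPoints X := fun x' =>
    AlgPoints.map jc (AlgPoints.map πrO (AlgPoints.map jV x'.1))
  have hFmem : ∀ x' : Src, (AlgPoints.map jV x'.1).pt ∈ πrO.left ⁻¹ᵁ U := fun x' => by
    change W.ι (πr ((g'.left ⁻¹ᵁ O).ι x'.1.pt)) ∉ C
    exact (hbdry _).1 x'.2
  let k : Src → {z : Motives.ComplexPoints X'O // z.pt ∈ πrO.left ⁻¹ᵁ U} := fun x' =>
    ⟨AlgPoints.map jV x'.1, hFmem x'⟩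
  have hk : IsEmbedding k :=
    ((AlgPoints.isOpenEmbedding_map_holds jV).isEmbedding.comp IsEmbedding.subtypeVal).codRestrict
      {z : Motives.ComplexPoints X'O | z.pt ∈ πrO.left ⁻¹ᵁ U} hFmem
  have hFfac : F = AlgPoints.map jc ∘ (fun z : {z : Motives.ComplexPoints X'O // z.pt ∈ πrO.left ⁻¹ᵁ U} =>
      (AlgPoints.map πrO z.1 : Motives.ComplexPoints Xc)) ∘ k := rfl
  have hFe : IsEmbedding F := by
    rw [hFfac]
    exact (AlgPoints.isOpenEmbedding_map_holds jc).isEmbedding.comp (hπre.comp hk)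
  -- its range
  have hrjc : Set.range (AlgPoints.map jc : Motives.ComplexPoints Xc → Motives.ComplexPoints X) =
      {x | x.pt ∈ W} := by
    rw [AlgPoints.range_map_of_isOpenImmersion_holds jc]
    ext Q
    change Q.pt ∈ W.ι.opensRange ↔ Q.pt ∈ W
    rw [Scheme.Opens.opensRange_ι]
  have hrjV : Set.range (AlgPoints.map jV : Motives.ComplexPoints X'V → Motives.ComplexPoints X'O) =
      {z | z.pt ∈ g'.left ⁻¹ᵁ O} := by
    rw [AlgPoints.range_map_of_isOpenImmersion_holds jV]
    ext Q
    change Q.pt ∈ (g'.left ⁻¹ᵁ O).ι.opensRange ↔ Q.pt ∈ g'.left ⁻¹ᵁ O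
    rw [Scheme.Opens.opensRange_ι]
  have hg'pt : ∀ z : Motives.ComplexPoints X'O,
      g.left (AlgPoints.map jc (AlgPoints.map πrO z)).pt = g'.left z.pt := fun z => rfl
  have hFrange : Set.range F = Tgt := by
    ext x
    constructor
    · rintro ⟨x', rfl⟩
      refine ⟨?_, ?_, ?_⟩
      · change (AlgPoints.map jc (AlgPoints.map πrO (AlgPoints.map jV x'.1))).pt ∈ W
        rw [AlgPoints.pt_map]
        change W.ι _ ∈ W
        rw [Scheme.Opens.ι_apply]
        exact Subtype.prop _
      · exact (hbdry _).1 x'.2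
      · rw [hg'pt]
        change g'.left ((g'.left ⁻¹ᵁ O).ι x'.1.pt) ∈ O
        rw [Scheme.Opens.ι_apply]
        exact (x'.1.pt).2
    · rintro ⟨hxW, hxC, hxO⟩
      obtain ⟨y, rfl⟩ : x ∈ Set.range (AlgPoints.map jc : Motives.ComplexPoints Xc → _) := by
        rw [hrjc]; exact hxW
      have hyU : (y : Motives.ComplexPoints Xc).pt ∈ U := by
        change W.ι y.pt ∉ C
        exact hxC
      obtain ⟨⟨z, hzU⟩, hz⟩ : y ∈ Set.range (fun z : {z : Motives.ComplexPoints X'O // z.pt ∈ πrO.left ⁻¹ᵁ U} =>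
          (AlgPoints.map πrO z.1 : Motives.ComplexPoints Xc)) := by rw [hπrr]; exact hyU
      have hz' : AlgPoints.map πrO z = y := hz
      have hzO : z.pt ∈ g'.left ⁻¹ᵁ O := by
        change g'.left z.pt ∈ O
        rw [← hg'pt z, hz']
        exact hxO
      obtain ⟨x', rfl⟩ : z ∈ Set.range (AlgPoints.map jV : Motives.ComplexPoints X'V → _) := by
        rw [hrjV]; exact hzO
      have hx' : ∀ D : {D // D ∈ E}, (g'.left ⁻¹ᵁ O).ι x'.pt ∉ D.1.support := (hbdry _).2 hzU
      exact ⟨⟨x', hx'⟩, by change AlgPoints.map jc (AlgPoints.map πrO (AlgPoints.map jV x')) = _; rw [hz']⟩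
  -- the homeomorphisms
  obtain ⟨α, hα⟩ := exists_homeomorph_of_range_eq (i := (Subtype.val : ↥Tgt → Motives.ComplexPoints X))
    IsEmbedding.subtypeVal hFe (by rw [hFrange]; exact Subtype.range_coe)
  have hrjO : Set.range (AlgPoints.map jO : Motives.ComplexPoints BO → Motives.ComplexPoints B) =
      {β | β.pt ∈ O} := by
    rw [AlgPoints.range_map_of_isOpenImmersion_holds jO]
    ext Q
    change Q.pt ∈ O.ι.opensRange ↔ Q.pt ∈ O
    rw [Scheme.Opens.opensRange_ι]
  obtain ⟨β, hβ⟩ := exists_homeomorph_of_range_eq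
    (i := (Subtype.val : {β : Motives.ComplexPoints B // β.pt ∈ O} → Motives.ComplexPoints B))
    IsEmbedding.subtypeVal (AlgPoints.isOpenEmbedding_map_holds jO).isEmbedding
    (by rw [hrjO]; exact Subtype.range_coe)
  -- ### transport
  refine IsLocallyTrivialFibration.of_homeomorph hF α β fun x => ?_
  apply (AlgPoints.isOpenEmbedding_map_holds jO).injective
  change AlgPoints.map jO (AlgPoints.map (restrictOverHom g' O) (α x).1) = AlgPoints.map jO (β _)
  rw [hβ, ← AlgPoints.map_comp_apply (restrictOverHom g' O) jO, restrictOverHom_comp_openSubschemeOverι,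
    AlgPoints.map_comp_apply]
  change AlgPoints.map (πrO ≫ jc ≫ g) (AlgPoints.map jV (α x).1) = AlgPoints.map g x.1
  rw [AlgPoints.map_comp_apply, AlgPoints.map_comp_apply]
  exact congrArg (AlgPoints.map g) (hα x)

end Piece

/-! ### The main result -/

section Main

variable {X B : Motives.SchemeOver ℂ} (g : X ⟶ B) {n d : ℕ}

/-- **Generic local triviality of the complement of a closed subset in a smooth proper family.**
Let `g : X ⟶ B` be proper and smooth of relative dimension `n`, with `B` an integral separated
`ℂ`-scheme of finite type, smooth over `ℂ` of relative dimension `d`, and let `C ⊆ X` be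
closed. Then there is an open `O ∋ η_B` of `B` such that
`{x ∈ X(ℂ) | x ∉ C(ℂ), g(x) ∈ O(ℂ)} → O(ℂ)` is a locally trivial fibration. (`X` is regular, so
its finitely many irreducible components are open, closed and pairwise disjoint
(`Resolution.Scheme.IsRegular.coe_irreducibleComponentOpen`); intersect the opens of
`exists_opens_isLocallyTrivialFibration_compl_of_isIrreducible` for the components not inside
`C`, and glue over the finite clopen partition of the total space by components
(`IsLocallyTrivialFibration.of_isLocallyConstant`); components inside `C` contribute an empty
piece.) This is the "Ehresmann for the pair, off the closed subfamily, over a dense open of the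
base" used in Voisin's and Charles–Schnell's argument for the algebraicity locus.
[cite: VoisinHodgeI2002, §9.1.1, Thm. 9.3, Prop. 9.5] [cite: VoisinHodgeII2003, §3.3.1]
[cite: CharlesSchnell2014Notes, Prop. 11.3.11 (proof)] -/
theorem exists_opens_isLocallyTrivialFibration_compl [IsProper g.left]
    [SmoothOfRelativeDimension n g.left] [IsIntegral B.left] [LocallyOfFiniteType B.hom]
    [SmoothOfRelativeDimension d B.hom] [IsSeparated B.hom] [CompactSpace B.left]
    (C : Set X.left) (hC : IsClosed C) :
    ∃ O : B.left.Opens, genericPoint B.left ∈ O ∧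
      IsLocallyTrivialFibration
        (fun x : {x : Motives.ComplexPoints X // x.pt ∉ C ∧ g.left x.pt ∈ O} =>
          (⟨AlgPoints.map g x.1, x.2.2⟩ : {β : Motives.ComplexPoints B // β.pt ∈ O})) := by
  classical
  -- ### `X` is Noetherian and regular: components are clopen and disjoint
  haveI : LocallyOfFiniteType X.hom := by rw [← Over.w g]; infer_instance
  haveI : SmoothOfRelativeDimension (n + d) X.hom := ComplexPoints.smoothOfRelativeDimension_hom_of_hom g n d
  haveI : CompactSpace X.left := QuasiCompact.compactSpace_of_compactSpace g.left
  haveI : IsLocallyNoetherian X.left := LocallyOfFiniteType.isLocallyNoetherian X.hom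
  haveI : IsNoetherian X.left := {}
  have hXreg : Scheme.IsRegular X.left := fun x =>
    isRegularLocalRing_stalk_of_smoothOfRelativeDimension X.hom (n + d) x
  let S : Set (Set X.left) := irreducibleComponents X.left
  have hSfin : S.Finite := NoetherianSpace.finite_irreducibleComponents
  haveI : Finite ↥S := hSfin.to_subtype
  let Wc : ↥S → X.left.Opens := fun c => X.left.irreducibleComponentOpen c.1
  have hWc : ∀ c : ↥S, (Wc c : Set X.left) = c.1 := fun c => hXreg.coe_irreducibleComponentOpen c.2
  have hWcl : ∀ c : ↥S, IsClosed (Wc c : Set X.left) := fun c => by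
    rw [hWc]; exact isClosed_of_mem_irreducibleComponents _ c.2
  have hWirr : ∀ c : ↥S, IsIrreducible (Wc c : Set X.left) := fun c => by
    rw [hWc]; exact c.2.1
  -- the component of a point
  let part : Motives.ComplexPoints X → ↥S := fun x =>
    ⟨irreducibleComponent x.pt, irreducibleComponent_mem_irreducibleComponents _⟩
  have hmem_part : ∀ x, x.pt ∈ Wc (part x) := fun x => by
    rw [← SetLike.mem_coe, hWc]
    exact mem_irreducibleComponent
  have hpart_eq : ∀ x c, x.pt ∈ Wc c → part x = c := fun x c hx => by
    rw [← SetLike.mem_coe, hWc] at hx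
    exact Subtype.ext (hXreg.eq_of_mem_irreducibleComponents x.pt
      (irreducibleComponent_mem_irreducibleComponents _) c.2 mem_irreducibleComponent hx)
  have hpart : IsLocallyConstant part := by
    rw [IsLocallyConstant.iff_isOpen_fiber]
    intro c
    have h : part ⁻¹' {c} = {x | x.pt ∈ Wc c} := by
      ext x
      simp only [Set.mem_preimage, Set.mem_singleton_iff, Set.mem_setOf_eq]
      exact ⟨fun h => h ▸ hmem_part x, hpart_eq x c⟩
    rw [h]
    exact AlgPoints.isOpen_setOf_pt_mem (Wc c)
  -- ### the opens of the pieces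
  have hpiece : ∀ c : ↥S, ∃ Oc : B.left.Opens, genericPoint B.left ∈ Oc ∧
      (c.1 ⊆ C ∨ IsLocallyTrivialFibration
        (fun x : {x : Motives.ComplexPoints X // x.pt ∈ Wc c ∧ x.pt ∉ C ∧ g.left x.pt ∈ Oc} =>
          (⟨AlgPoints.map g x.1, x.2.2.2⟩ : {β : Motives.ComplexPoints B // β.pt ∈ Oc}))) := by
    intro c
    by_cases hcC : c.1 ⊆ C
    · exact ⟨⊤, trivial, Or.inl hcC⟩
    · obtain ⟨Oc, hη, hT⟩ := exists_opens_isLocallyTrivialFibration_compl_of_isIrreducible g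
        (n := n) (d := d) (Wc c) (hWcl c) (hWirr c) C hC (by rw [hWc]; exact hcC)
      exact ⟨Oc, hη, Or.inr hT⟩
  choose Oc hηOc hOc using hpiece
  let O : B.left.Opens :=
    ⟨⋂ c, (Oc c : Set B.left), isOpen_iInter_of_finite fun c => (Oc c).isOpen⟩
  have hOle : ∀ c, (O : Set B.left) ⊆ Oc c := fun c => Set.iInter_subset _ c
  refine ⟨O, Set.mem_iInter.2 hηOc, ?_⟩
  -- ### glue over the partition by components
  let Tot := {x : Motives.ComplexPoints X // x.pt ∉ C ∧ g.left x.pt ∈ O}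
  let proj : Tot → {β : Motives.ComplexPoints B // β.pt ∈ O} := fun x =>
    ⟨AlgPoints.map g x.1, x.2.2⟩
  change IsLocallyTrivialFibration proj
  refine IsLocallyTrivialFibration.of_isLocallyConstant (fun x : Tot => part x.1)
    (hpart.comp_continuous continuous_subtype_val) fun c => ?_
  rcases hOc c with hcC | hT
  · -- a component inside `C`: empty piece
    haveI : IsEmpty {x : Tot // part x.1 = c} := ⟨fun x => x.1.2.1 (by
      have h := hmem_part x.1.1
      rw [x.2, ← SetLike.mem_coe, hWc] at h
      exact hcC h)⟩
    exact IsLocallyTrivialFibration.of_isEmpty _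
  · -- a component not inside `C`: restrict the triviality over `Oc c` to `O` and transport
    let O' : Set {β : Motives.ComplexPoints B // β.pt ∈ Oc c} := {β | β.1.pt ∈ O}
    have hO' : IsOpen O' := (AlgPoints.isOpen_setOf_pt_mem O).preimage continuous_subtype_val
    have hT' := hT.restrict_preimage hO'
    -- the homeomorphisms of total spaces and bases
    obtain ⟨α, hα⟩ := exists_homeomorph_of_range_eq
      (i := fun x : {x : Tot // part x.1 = c} => (x.1.1 : Motives.ComplexPoints X))
      (j := fun y : ↥((fun x : {x : Motives.ComplexPoints X // x.pt ∈ Wc c ∧ x.pt ∉ C ∧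
          g.left x.pt ∈ Oc c} => (⟨AlgPoints.map g x.1, x.2.2.2⟩ :
            {β : Motives.ComplexPoints B // β.pt ∈ Oc c})) ⁻¹' O') =>
        (y.1.1 : Motives.ComplexPoints X))
      (IsEmbedding.subtypeVal.comp IsEmbedding.subtypeVal)
      (IsEmbedding.subtypeVal.comp IsEmbedding.subtypeVal) (by
        ext z
        constructor
        · rintro ⟨x, rfl⟩
          exact ⟨⟨⟨x.1.1, (congrArg (fun c' => x.1.1.pt ∈ Wc c') x.2).mp (hmem_part x.1.1),
            x.1.2.1, hOle c x.1.2.2⟩, x.1.2.2⟩, rfl⟩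
        · rintro ⟨y, rfl⟩
          exact ⟨⟨⟨y.1.1, y.1.2.2.1, y.2⟩, hpart_eq _ c y.1.2.1⟩, rfl⟩)
    obtain ⟨β, hβ⟩ := exists_homeomorph_of_range_eq
      (i := fun b : {β : Motives.ComplexPoints B // β.pt ∈ O} => (b.1 : Motives.ComplexPoints B))
      (j := fun b : ↥O' => (b.1.1 : Motives.ComplexPoints B))
      IsEmbedding.subtypeVal (IsEmbedding.subtypeVal.comp IsEmbedding.subtypeVal) (by
        ext z
        constructor
        · rintro ⟨b, rfl⟩
          exact ⟨⟨⟨b.1, hOle c b.2⟩, b.2⟩, rfl⟩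
        · rintro ⟨b', rfl⟩
          exact ⟨⟨b'.1.1, b'.2⟩, rfl⟩)
    refine IsLocallyTrivialFibration.of_homeomorph hT' α β fun x => ?_
    apply Subtype.ext
    apply Subtype.ext
    change AlgPoints.map g ((α x).1.1 : Motives.ComplexPoints X) = ((β (proj x.1)).1.1 : Motives.ComplexPoints B)
    rw [hβ, hα]

end Main




end Part2

/-! ## Part 3 — parameter-space form, dichotomy input, capstone, discharge -/

section Part3
open Order


/-! ### Generic local triviality of the complement, over an irreducible closed subset of the parameter space -/

section Generic

variable {𝒳 S T : Motives.SchemeOver ℂ} (f : 𝒳 ⟶ S) (h : T ⟶ S) {n : ℕ}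

/-- **Generic local triviality of the complement of a closed subfamily.** Let `f : 𝒳 ⟶ S` be
proper and smooth of relative dimension `n`, `S` separated, `h : T ⟶ S` with `T` separated and of
finite type over `ℂ`, `𝒵 ⊆ 𝒳 × T` Zariski-closed and `Y ⊆ T` closed irreducible. Then there is
an open `O ⊆ T` meeting `Y` such that for every open `O' ≤ O` the projection
`{(y, x) | y ∈ (Y ∩ O')(ℂ), f x = h y, (x, y) ∉ 𝒵} → (Y ∩ O')(ℂ)` is a locally trivial
fibration. Proof: give `Y` its reduced structure `W` (`ClosedSubvariety.ofPoint`), an integral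
`ℂ`-scheme of finite type whose regular locus `B = W ∩ O₁` is open, dense and smooth over `ℂ`
(Matsumura §30); apply `exists_opens_isLocallyTrivialFibration_compl` to the proper smooth
family `𝒳 ×_S B → B` and the preimage of `𝒵`, obtaining a dense open `O₂ ⊆ B`, the trace of an
open `O₃ ⊆ T`; put `O = O₁ ∩ O₃` and transport along `(𝒳 ×_S B)(ℂ) ≃ {(x, β) | f x = h β}` and
the embedding `B(ℂ) ↪ T(ℂ)` onto the complex points over `Y ∩ O₁`.
[cite: VoisinHodgeI2002, §9.1.1] [cite: CharlesSchnell2014Notes, Prop. 11.3.11 (proof)]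
[cite: Hartshorne1977, II.3 Thm. 3.3] -/
theorem isLocallyTrivialFibration_compl_generic [IsProper f.left]
    [SmoothOfRelativeDimension n f.left] [IsSeparated S.hom] [IsSeparated T.hom]
    [LocallyOfFiniteType T.hom] [CompactSpace T.left] (𝒵 : Set (𝒳 ⊗ T).left)
    (h𝒵 : IsClosed 𝒵) {Y : Set T.left} (hYc : IsClosed Y) (hY : IsIrreducible Y) :
    ∃ O : T.left.Opens, (Y ∩ (O : Set T.left)).Nonempty ∧ ∀ O' : T.left.Opens, O' ≤ O →
      IsLocallyTrivialFibration
        (fun q : {q : {y : Motives.ComplexPoints T // y.pt ∈ Y ∧ y.pt ∈ (O' : Set T.left)} ×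
            Motives.ComplexPoints 𝒳 //
            AlgPoints.map f q.2 = AlgPoints.map h q.1.1 ∧
              (AlgPoints.prodEquiv.symm (q.2, (q.1.1 : Motives.ComplexPoints T)) :
                Motives.ComplexPoints (𝒳 ⊗ T)).pt ∉ 𝒵} => q.1.1) := by
  classical
  -- ### the reduced structure `W` on `Y` and its regular locus `B = W ∩ O₁`
  let ξ : T.left := hY.genericPoint
  let W : ClosedSubvariety T.left := ClosedSubvariety.ofPoint T.left ξ
  have hWrange : Set.range W.ι = Y := by
    rw [ClosedSubvariety.range_ofPoint_ι]
    exact hY.closure_genericPoint hYc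
  let WO : Motives.SchemeOver ℂ := Over.mk (W.ι ≫ T.hom)
  let jW : WO ⟶ T := Over.homMk W.ι rfl
  haveI : IsClosedImmersion jW.left := inferInstanceAs (IsClosedImmersion W.ι)
  have hlt : LocallyOfFiniteType (W.ι ≫ T.hom) := inferInstance
  haveI : LocallyOfFiniteType WO.hom := hlt
  have hReg : IsOpen (Scheme.regularLocus W.carrier) :=
    @isOpen_regularLocus_of_locallyOfFiniteType_perfectField ℂ _ _ W.carrier (W.ι ≫ T.hom) hlt
  have hξReg : genericPoint W.carrier ∈ Scheme.regularLocus W.carrier := by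
    change IsRegularLocalRing W.carrier.functionField
    infer_instance
  obtain ⟨O₁, hO₁, hO₁Reg⟩ := W.ι.isClosedEmbedding.isInducing.isOpen_iff.mp hReg
  let U : W.carrier.Opens := W.ι ⁻¹ᵁ ⟨O₁, hO₁⟩
  have hηU : genericPoint W.carrier ∈ U := by
    change genericPoint W.carrier ∈ W.ι ⁻¹' O₁
    rw [hO₁Reg]; exact hξReg
  let B : Motives.SchemeOver ℂ := openSubschemeOver WO U
  let iU : B ⟶ WO := openSubschemeOverι WO U
  haveI : IsOpenImmersion iU.left := inferInstanceAs (IsOpenImmersion U.ι)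
  have hltU : LocallyOfFiniteType (U.ι ≫ W.ι ≫ T.hom) := inferInstance
  haveI : LocallyOfFiniteType B.hom := hltU
  have hUreg : Scheme.IsRegular B.left := by
    intro x
    have hx : U.ι x ∈ Scheme.regularLocus W.carrier := by
      have h1 : U.ι x ∈ (U : Set W.carrier) := by
        rw [Scheme.Opens.ι_apply]
        exact x.2
      have h2 : U.ι x ∈ W.ι ⁻¹' O₁ := h1
      rwa [hO₁Reg] at h2
    haveI : IsRegularLocalRing (W.carrier.presheaf.stalk (U.ι x)) := hx
    exact IsRegularLocalRing.of_ringEquiv (asIso (U.ι.stalkMap x)).commRingCatIsoToRingEquiv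
  haveI : Smooth B.hom :=
    @smooth_of_isRegular_of_perfectField ℂ _ _ B.left (U.ι ≫ W.ι ≫ T.hom) hltU hUreg
  haveI : Nonempty B.left := ⟨⟨genericPoint W.carrier, hηU⟩⟩
  haveI : IsIntegral B.left :=
    @isIntegral_of_isOpenImmersion (U : Scheme) W.carrier U.ι inferInstance inferInstance
      ⟨⟨genericPoint W.carrier, hηU⟩⟩
  haveI : IsSeparated B.hom := inferInstanceAs (IsSeparated (U.ι ≫ W.ι ≫ T.hom))
  haveI : CompactSpace W.carrier := W.ι.isClosedEmbedding.compactSpace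
  haveI : IsLocallyNoetherian W.carrier := LocallyOfFiniteType.isLocallyNoetherian (W.ι ≫ T.hom)
  haveI : IsNoetherian W.carrier := {}
  haveI : CompactSpace B.left :=
    isCompact_iff_compactSpace.mp (NoetherianSpace.isCompact (U : Set W.carrier))
  obtain ⟨d, hd⟩ := exists_smoothOfRelativeDimension_of_smooth B.hom
  haveI := hd
  -- the immersion `b : B ⟶ T`, an embedding of complex points onto those over `Y ∩ O₁`
  let b : B ⟶ T := iU ≫ jW
  have hcompb : (AlgPoints.map b : Motives.ComplexPoints B → Motives.ComplexPoints T) =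
      AlgPoints.map jW ∘ AlgPoints.map iU :=
    funext fun P => AlgPoints.map_comp_apply iU jW P
  have hbe : IsEmbedding (AlgPoints.map b : Motives.ComplexPoints B → Motives.ComplexPoints T) := by
    rw [hcompb]
    exact (AlgPoints.isEmbedding_map_of_isClosedImmersion (L := ℂ) jW).comp
      (AlgPoints.isOpenEmbedding_map_holds (L := ℂ) iU).isEmbedding
  have hbpt : ∀ β : Motives.ComplexPoints B, (AlgPoints.map b β).pt = W.ι (U.ι β.pt) := fun β => rfl
  have hbY : ∀ β : Motives.ComplexPoints B, (AlgPoints.map b β).pt ∈ Y := fun β => by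
    rw [hbpt, ← hWrange]; exact ⟨_, rfl⟩
  have hbO₁ : ∀ β : Motives.ComplexPoints B, (AlgPoints.map b β).pt ∈ O₁ := fun β => by
    rw [hbpt]
    change U.ι β.pt ∈ W.ι ⁻¹' O₁
    have h1 : U.ι β.pt ∈ (U : Set W.carrier) := by rw [Scheme.Opens.ι_apply]; exact (β.pt).2
    exact h1
  have hblift : ∀ y : Motives.ComplexPoints T, y.pt ∈ Y → y.pt ∈ O₁ →
      ∃ β : Motives.ComplexPoints B, AlgPoints.map b β = y := by
    intro y hyY hyO
    have hy : y ∈ Set.range (AlgPoints.map jW : Motives.ComplexPoints WO → _) := by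
      rw [range_map_eq_setOf_pt_mem_range jW]
      change y.pt ∈ Set.range W.ι
      rw [hWrange]; exact hyY
    obtain ⟨w, rfl⟩ := hy
    have hwU : w.pt ∈ U := hyO
    have hw : w ∈ Set.range (AlgPoints.map iU : Motives.ComplexPoints B → _) := by
      rw [AlgPoints.range_map_of_isOpenImmersion_holds iU]
      change w.pt ∈ U.ι.opensRange
      rw [Scheme.Opens.opensRange_ι]; exact hwU
    obtain ⟨β, rfl⟩ := hw
    exact ⟨β, AlgPoints.map_comp_apply iU jW β⟩
  -- ### the family over `B` and the preimage of `𝒵`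
  let XB : Motives.SchemeOver ℂ := pullbackOver f (b ≫ h)
  let gB : XB ⟶ B := pullbackOver.snd f (b ≫ h)
  let pB : XB ⟶ 𝒳 := pullbackOver.fst f (b ≫ h)
  haveI : IsProper gB.left := by
    change IsProper (pullback.snd f.left (b ≫ h).left)
    infer_instance
  haveI : SmoothOfRelativeDimension n gB.left := by
    change SmoothOfRelativeDimension n (pullback.snd f.left (b ≫ h).left)
    haveI := smoothOfRelativeDimension_isStableUnderBaseChange (n := n)
    exact MorphismProperty.pullback_snd (P := @SmoothOfRelativeDimension n) _ _ inferInstance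
  let toXT : XB ⟶ 𝒳 ⊗ T := CartesianMonoidalCategory.lift pB (gB ≫ b)
  let CB : Set XB.left := toXT.left ⁻¹' 𝒵
  have hCB : IsClosed CB := h𝒵.preimage toXT.left.continuous
  have htoXT : ∀ z : Motives.ComplexPoints XB, AlgPoints.map toXT z =
      AlgPoints.prodEquiv.symm (AlgPoints.map pB z, AlgPoints.map b (AlgPoints.map gB z)) := by
    intro z
    rw [AlgPoints.prodEquiv_symm_apply, ← AlgPoints.map_comp_apply gB b z]
    simp only [AlgPoints.map_apply, toXT, CartesianMonoidalCategory.comp_lift]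
  have hCBiff : ∀ z : Motives.ComplexPoints XB, z.pt ∈ CB ↔
      (AlgPoints.prodEquiv.symm (AlgPoints.map pB z, AlgPoints.map b (AlgPoints.map gB z)) :
        Motives.ComplexPoints (𝒳 ⊗ T)).pt ∈ 𝒵 := fun z => by
    rw [← htoXT]; rfl
  -- ### the heart: generic local triviality over `B`
  obtain ⟨O₂, hηO₂, hF⟩ := exists_opens_isLocallyTrivialFibration_compl gB (n := n) (d := d) CB hCB
  -- ### the open `O = O₁ ∩ O₃` of `T`, `b⁻¹(O₃) = O₂`
  have hbind : IsInducing (b.left : B.left → T.left) := by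
    change IsInducing (W.ι ∘ U.ι)
    exact W.ι.isClosedEmbedding.isInducing.comp U.ι.isOpenEmbedding.isInducing
  obtain ⟨O₃, hO₃, hO₃eq⟩ := hbind.isOpen_iff.mp O₂.isOpen
  let O : T.left.Opens := ⟨O₁ ∩ O₃, hO₁.inter hO₃⟩
  have hβO : ∀ β : Motives.ComplexPoints B, β.pt ∈ O₂ ↔ (AlgPoints.map b β).pt ∈ O₃ := fun β => by
    rw [← SetLike.mem_coe, ← hO₃eq]; rfl
  have hOO₁ : ∀ t : T.left, t ∈ (O : Set T.left) → t ∈ O₁ := fun t ht => ht.1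
  have hOO₃ : ∀ t : T.left, t ∈ (O : Set T.left) → t ∈ O₃ := fun t ht => ht.2
  refine ⟨O, ⟨W.ι (U.ι (genericPoint B.left)), ?_, ?_, ?_⟩, fun O' hO' => ?_⟩
  · rw [← hWrange]; exact ⟨_, rfl⟩
  · change U.ι (genericPoint B.left) ∈ W.ι ⁻¹' O₁
    have h1 : U.ι (genericPoint B.left) ∈ (U : Set W.carrier) := by
      rw [Scheme.Opens.ι_apply]; exact Subtype.prop _
    exact h1
  · change (genericPoint B.left) ∈ (fun x => W.ι (U.ι x)) ⁻¹' O₃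
    have h1 : (b.left : B.left → T.left) ⁻¹' O₃ = O₂ := hO₃eq
    have h2 : (genericPoint B.left) ∈ (b.left : B.left → T.left) ⁻¹' O₃ := by
      rw [h1]; exact hηO₂
    exact h2
  -- ### the fibration over the complex points of `Y ∩ O'`
  have hO'₁ : ∀ t : T.left, t ∈ (O' : Set T.left) → t ∈ O₁ := fun t ht => hOO₁ t (hO' ht)
  have hO'₃ : ∀ t : T.left, t ∈ (O' : Set T.left) → t ∈ O₃ := fun t ht => hOO₃ t (hO' ht)
  let Wset : Set (Motives.ComplexPoints T) := {y | y.pt ∈ Y ∧ y.pt ∈ (O' : Set T.left)}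
  -- restrict the heart's fibration to the complex points of `B` over `O'`
  let projB : {z : Motives.ComplexPoints XB // z.pt ∉ CB ∧ gB.left z.pt ∈ O₂} →
      {β : Motives.ComplexPoints B // β.pt ∈ O₂} := fun z => ⟨AlgPoints.map gB z.1, z.2.2⟩
  let O'' : Set {β : Motives.ComplexPoints B // β.pt ∈ O₂} :=
    {β | (AlgPoints.map b β.1).pt ∈ (O' : Set T.left)}
  have hO'' : IsOpen O'' :=
    ((AlgPoints.isOpen_setOf_pt_mem O').preimage (AlgPoints.continuous_map b)).preimage
      continuous_subtype_val
  have hF' : IsLocallyTrivialFibration (O''.restrictPreimage projB) := hF.restrict_preimage hO''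
  -- the points homeomorphism of `𝒳 ×_S B`
  obtain ⟨ψ, hψ⟩ := exists_pullbackPointsHomeomorph f (b ≫ h)
  have hψ₁ : ∀ P : Motives.ComplexPoints XB, ((ψ P).1).1 = AlgPoints.map pB P := fun P =>
    congrArg Prod.fst (hψ P)
  have hψ₂ : ∀ P : Motives.ComplexPoints XB, ((ψ P).1).2 = AlgPoints.map gB P := fun P =>
    congrArg Prod.snd (hψ P)
  have hcond : ∀ P : Motives.ComplexPoints XB,
      AlgPoints.map f (AlgPoints.map pB P) = AlgPoints.map h (AlgPoints.map b (AlgPoints.map gB P)) := by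
    intro P
    rw [← AlgPoints.map_comp_apply pB f P, pullbackOver.condition, AlgPoints.map_comp_apply,
      AlgPoints.map_comp_apply]
  -- ### total spaces: two embeddings into `𝒳(ℂ) × T(ℂ)` with the same range
  let TotP := {q : ↥Wset × Motives.ComplexPoints 𝒳 //
    AlgPoints.map f q.2 = AlgPoints.map h q.1.1 ∧
      (AlgPoints.prodEquiv.symm (q.2, (q.1.1 : Motives.ComplexPoints T)) :
        Motives.ComplexPoints (𝒳 ⊗ T)).pt ∉ 𝒵}
  let TotB := ↥(projB ⁻¹' O'')
  let iP : TotP → Motives.ComplexPoints 𝒳 × Motives.ComplexPoints T := fun q => (q.1.2, (q.1.1 : Motives.ComplexPoints T))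
  let jB : TotB → Motives.ComplexPoints 𝒳 × Motives.ComplexPoints T := fun z =>
    (AlgPoints.map pB z.1.1, AlgPoints.map b (AlgPoints.map gB z.1.1))
  have hiP : IsEmbedding iP := by
    have hfac : iP = (Homeomorph.prodComm (Motives.ComplexPoints T) (Motives.ComplexPoints 𝒳)) ∘
        Prod.map (Subtype.val : ↥Wset → Motives.ComplexPoints T) id ∘
          (Subtype.val : TotP → ↥Wset × Motives.ComplexPoints 𝒳) := by
      funext q; rfl
    rw [hfac]
    exact (Homeomorph.prodComm _ _).isEmbedding.comp
      ((IsEmbedding.subtypeVal.prodMap IsEmbedding.id).comp IsEmbedding.subtypeVal)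
  have hjB : IsEmbedding jB := by
    have hfac : jB = Prod.map id (AlgPoints.map b : Motives.ComplexPoints B → Motives.ComplexPoints T) ∘
        (fun P : Motives.ComplexPoints XB => ((ψ P).1 : Motives.ComplexPoints 𝒳 × Motives.ComplexPoints B)) ∘
          (fun z : TotB => (z.1.1 : Motives.ComplexPoints XB)) := by
      funext z
      change (AlgPoints.map pB z.1.1, AlgPoints.map b (AlgPoints.map gB z.1.1)) =
        (((ψ z.1.1).1).1, AlgPoints.map b ((ψ z.1.1).1).2)
      rw [hψ₁, hψ₂]
    rw [hfac]
    exact (IsEmbedding.id.prodMap hbe).comp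
      ((IsEmbedding.subtypeVal.comp ψ.isEmbedding).comp
        (IsEmbedding.subtypeVal.comp IsEmbedding.subtypeVal))
  have hrange : Set.range iP = Set.range jB := by
    ext ⟨x, y⟩
    constructor
    · rintro ⟨q, hq⟩
      have hx : q.1.2 = x := congrArg Prod.fst hq
      have hy : (q.1.1 : Motives.ComplexPoints T) = y := congrArg Prod.snd hq
      obtain ⟨β, hβ⟩ := hblift y (hy ▸ q.1.1.2.1) (hO'₁ _ (hy ▸ q.1.1.2.2))
      have hfx : AlgPoints.map f x = AlgPoints.map (b ≫ h) β := by
        rw [AlgPoints.map_comp_apply, hβ, ← hx, ← hy]; exact q.2.1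
      let z₀ : Motives.ComplexPoints XB := ψ.symm ⟨(x, β), hfx⟩
      have hz₀ : ψ z₀ = ⟨(x, β), hfx⟩ := ψ.apply_symm_apply _
      have hz₀₁ : AlgPoints.map pB z₀ = x := by rw [← hψ₁, hz₀]
      have hz₀₂ : AlgPoints.map gB z₀ = β := by rw [← hψ₂, hz₀]
      have hzC : z₀.pt ∉ CB := by
        rw [hCBiff, hz₀₁, hz₀₂, hβ, ← hx, ← hy]; exact q.2.2
      have hzO₂ : gB.left z₀.pt ∈ O₂ := by
        change (AlgPoints.map gB z₀).pt ∈ O₂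
        rw [hz₀₂, hβO, hβ, ← hy]
        exact hO'₃ _ q.1.1.2.2
      have hzO'' : projB ⟨z₀, hzC, hzO₂⟩ ∈ O'' := by
        change (AlgPoints.map b (AlgPoints.map gB z₀)).pt ∈ (O' : Set T.left)
        rw [hz₀₂, hβ, ← hy]; exact q.1.1.2.2
      refine ⟨⟨⟨z₀, hzC, hzO₂⟩, hzO''⟩, ?_⟩
      change (AlgPoints.map pB z₀, AlgPoints.map b (AlgPoints.map gB z₀)) = (x, y)
      rw [hz₀₁, hz₀₂, hβ]
    · rintro ⟨z, hz⟩
      have hx : AlgPoints.map pB z.1.1 = x := congrArg Prod.fst hz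
      have hy : AlgPoints.map b (AlgPoints.map gB z.1.1) = y := congrArg Prod.snd hz
      have hyY : y.pt ∈ Y := hy ▸ hbY _
      have hyO' : y.pt ∈ (O' : Set T.left) := by rw [← hy]; exact z.2
      have hfx : AlgPoints.map f x = AlgPoints.map h y := by rw [← hx, ← hy]; exact hcond _
      have h𝒵 : (AlgPoints.prodEquiv.symm (x, y) : Motives.ComplexPoints (𝒳 ⊗ T)).pt ∉ 𝒵 := by
        rw [← hx, ← hy, ← hCBiff]; exact z.1.2.1
      exact ⟨⟨(⟨y, hyY, hyO'⟩, x), hfx, h𝒵⟩, rfl⟩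
  obtain ⟨α, hα⟩ := exists_homeomorph_of_range_eq hiP hjB hrange
  -- ### bases: `(Y ∩ O')(ℂ)` and the complex points of `B` over `O'`
  have hrangeW : Set.range (Subtype.val : ↥Wset → Motives.ComplexPoints T) =
      Set.range (fun β : ↥O'' => (AlgPoints.map b β.1.1 : Motives.ComplexPoints T)) := by
    rw [Subtype.range_coe]
    ext y
    constructor
    · rintro ⟨hyY, hyO'⟩
      obtain ⟨β, hβ⟩ := hblift y hyY (hO'₁ _ hyO')
      have hβ₂ : β.pt ∈ O₂ := by rw [hβO, hβ]; exact hO'₃ _ hyO'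
      have hβ' : (⟨β, hβ₂⟩ : {β : Motives.ComplexPoints B // β.pt ∈ O₂}) ∈ O'' := by
        change (AlgPoints.map b β).pt ∈ (O' : Set T.left)
        rw [hβ]; exact hyO'
      exact ⟨⟨⟨β, hβ₂⟩, hβ'⟩, hβ⟩
    · rintro ⟨β, rfl⟩
      exact ⟨hbY _, β.2⟩
  obtain ⟨βW, hβW⟩ := exists_homeomorph_of_range_eq (IsEmbedding.subtypeVal)
    ((hbe.comp IsEmbedding.subtypeVal).comp IsEmbedding.subtypeVal) hrangeW
  have hβW' : ∀ w : ↥Wset, AlgPoints.map b (βW w).1.1 = w.1 := hβW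
  -- ### transport
  refine IsLocallyTrivialFibration.of_homeomorph hF' α βW fun q => ?_
  apply Subtype.ext
  apply Subtype.ext
  apply hbe.injective
  change AlgPoints.map b (AlgPoints.map gB (α q).1.1) = AlgPoints.map b (βW q.1.1).1.1
  rw [hβW']
  exact congrArg Prod.snd (hα q)

end Generic

/-! ### Repackaging: path connected relative neighbourhoods and trivialisations over them -/

section Bridge

variable {𝒳 S T : Motives.SchemeOver ℂ} (f : 𝒳 ⟶ S) (h : T ⟶ S) {n : ℕ}

/-- **Trivialisations of the complement over small path connected relative neighbourhoods**, the
hypothesis `htriv` of `dichotomy_of_complTrivialisation`, for every open `O' ≤ O`: from the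
local triviality of `isLocallyTrivialFibration_compl_generic` over the complex points of
`Y ∩ O'`, and the local path-connectedness of those complex points over the generic part of `Y`
(`exists_opens_locallyPathConnectedSpace_setOf_pt_mem`, SGA1 XII 2.4): shrink a trivialising
neighbourhood to a path connected one and restrict the trivialisation.
[cite: SGA1, Exp. XII Prop. 2.4] [cite: CharlesSchnell2014Notes, Prop. 11.3.11 (proof)] -/
theorem complTrivialisation_generic [IsProper f.left] [SmoothOfRelativeDimension n f.left]
    [IsSeparated S.hom] [IsSeparated T.hom] [LocallyOfFiniteType T.hom] [CompactSpace T.left]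
    (𝒵 : Set (𝒳 ⊗ T).left) (h𝒵 : IsClosed 𝒵) {Y : Set T.left} (hYc : IsClosed Y)
    (hY : IsIrreducible Y) :
    ∃ O : T.left.Opens, (Y ∩ (O : Set T.left)).Nonempty ∧
      ∀ O' : T.left.Opens, O' ≤ O →
        ∀ y₀ : Motives.ComplexPoints T, y₀.pt ∈ Y ∧ y₀.pt ∈ (O' : Set T.left) →
        ∃ V : Set (Motives.ComplexPoints T),
          V ⊆ {y | y.pt ∈ Y ∧ y.pt ∈ (O' : Set T.left)} ∧
          V ∈ 𝓝[{y | y.pt ∈ Y ∧ y.pt ∈ (O' : Set T.left)}] y₀ ∧ IsPathConnected V ∧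
          ∃ (K : Type) (_ : TopologicalSpace K)
            (φ : ↥V × K ≃ₜ {q : ↥V × Motives.ComplexPoints 𝒳 //
              AlgPoints.map f q.2 = AlgPoints.map h q.1.1 ∧
                (AlgPoints.prodEquiv.symm (q.2, (q.1.1 : Motives.ComplexPoints T)) :
                  Motives.ComplexPoints (𝒳 ⊗ T)).pt ∉ 𝒵}),
            ∀ x, (φ x).1.1 = x.1 := by
  obtain ⟨OV, hYOV, hLT⟩ := isLocallyTrivialFibration_compl_generic f h (n := n) 𝒵 h𝒵 hYc hY
  obtain ⟨O₁, hYO₁, hlpc⟩ := exists_opens_locallyPathConnectedSpace_setOf_pt_mem (T := T) hYc hY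
  have hYO : (Y ∩ ((OV ⊓ O₁ : T.left.Opens) : Set T.left)).Nonempty := by
    obtain ⟨q, hqY, hq⟩ := hY.isPreirreducible _ _ OV.2 O₁.2
      (by obtain ⟨q, hqY, hq⟩ := hYOV; exact ⟨q, hqY, hq⟩)
      (by obtain ⟨q, hqY, hq⟩ := hYO₁; exact ⟨q, hqY, hq⟩)
    exact ⟨q, hqY, hq⟩
  refine ⟨OV ⊓ O₁, hYO, fun O' hO' y₀ hy₀ => ?_⟩
  -- the fibration over the complex points of `Y ∩ O'`
  set W' : Set (Motives.ComplexPoints T) := {y | y.pt ∈ Y ∧ y.pt ∈ (O' : Set T.left)} with hW'def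
  let TotP := {q : ↥W' × Motives.ComplexPoints 𝒳 //
    AlgPoints.map f q.2 = AlgPoints.map h q.1.1 ∧
      (AlgPoints.prodEquiv.symm (q.2, (q.1.1 : Motives.ComplexPoints T)) :
        Motives.ComplexPoints (𝒳 ⊗ T)).pt ∉ 𝒵}
  let P : TotP → ↥W' := fun q => q.1.1
  have hLT' : IsLocallyTrivialFibration P := hLT O' (hO'.trans inf_le_left)
  haveI : LocallyPathConnectedSpace ↥W' := hlpc O' (hO'.trans inf_le_right)
  let y₀' : ↥W' := ⟨y₀, hy₀⟩
  obtain ⟨U₁, hU₁o, hy₀U₁, φ₁, hφ₁⟩ := hLT' y₀'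
  -- a path connected neighbourhood `V₁ ⊆ U₁` of `y₀`
  obtain ⟨V₁, ⟨hV₁n, hV₁pc⟩, hV₁U₁⟩ :=
    (LocallyPathConnectedSpace.path_connected_basis (X := ↥W') y₀').mem_iff.1 (hU₁o.mem_nhds hy₀U₁)
  let V : Set (Motives.ComplexPoints T) := Subtype.val '' V₁
  have hVW' : V ⊆ W' := by
    rintro _ ⟨v, _, rfl⟩
    exact v.2
  have hVn : V ∈ 𝓝[W'] y₀ := by
    rw [nhdsWithin_eq_map_subtype_coe (s := W') (a := y₀) hy₀]
    exact Filter.image_mem_map hV₁n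
  have hVpc : IsPathConnected V := hV₁pc.image continuous_subtype_val
  have hmemV₁ : ∀ v : ↥V, (⟨v.1, hVW' v.2⟩ : ↥W') ∈ V₁ := by
    rintro ⟨_, w, hw, rfl⟩
    exact hw
  refine ⟨V, hVW', hVn, hVpc, ↥(P ⁻¹' {y₀'}), inferInstance, ?_⟩
  -- ### the trivialisation over `V`: restrict `φ₁` and reshuffle
  let φV : {p : ↥U₁ × ↥(P ⁻¹' {y₀'}) // (p.1 : ↥W') ∈ V₁} ≃ₜ
      {z : ↥(P ⁻¹' U₁) // P z.1 ∈ V₁} :=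
    φ₁.subtype fun p => by rw [hφ₁ p]
  have hφV : ∀ p, ((φV p).1 : TotP) = (φ₁ p.1 : TotP) := fun p => rfl
  -- source reshuffle `V × K ≃ₜ {p : U₁ × K // p.1 ∈ V₁}` via embeddings into `T(ℂ) × K`
  obtain ⟨e₁, he₁⟩ := exists_homeomorph_of_range_eq
    (i := Prod.map (Subtype.val : ↥V → Motives.ComplexPoints T) (id : ↥(P ⁻¹' {y₀'}) → _))
    (j := fun p : {p : ↥U₁ × ↥(P ⁻¹' {y₀'}) // (p.1 : ↥W') ∈ V₁} =>
      (((p.1.1 : ↥W') : Motives.ComplexPoints T), p.1.2))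
    (IsEmbedding.subtypeVal.prodMap IsEmbedding.id)
    (((IsEmbedding.subtypeVal.comp IsEmbedding.subtypeVal).prodMap IsEmbedding.id).comp
      IsEmbedding.subtypeVal) (by
      ext ⟨t, k⟩
      constructor
      · rintro ⟨⟨v, k'⟩, hvk⟩
        have hvk' : ((v : Motives.ComplexPoints T), k') = (t, k) := hvk
        obtain ⟨rfl, rfl⟩ := Prod.mk.inj hvk'
        exact ⟨⟨(⟨⟨v.1, hVW' v.2⟩, hV₁U₁ (hmemV₁ v)⟩, k'), hmemV₁ v⟩, rfl⟩
      · rintro ⟨⟨⟨u, k'⟩, hu⟩, huk⟩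
        have huk' : (((u : ↥W') : Motives.ComplexPoints T), k') = (t, k) := huk
        obtain ⟨rfl, rfl⟩ := Prod.mk.inj huk'
        exact ⟨(⟨((u : ↥W') : Motives.ComplexPoints T), ⟨(u : ↥W'), hu, rfl⟩⟩, k'), rfl⟩)
  -- target reshuffle via embeddings into `T(ℂ) × 𝒳(ℂ)`
  obtain ⟨e₂, he₂⟩ := exists_homeomorph_of_range_eq
    (i := fun z : {z : ↥(P ⁻¹' U₁) // P z.1 ∈ V₁} =>
      ((((z.1 : TotP).1.1 : ↥W') : Motives.ComplexPoints T), (z.1 : TotP).1.2))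
    (j := fun q : {q : ↥V × Motives.ComplexPoints 𝒳 //
        AlgPoints.map f q.2 = AlgPoints.map h q.1.1 ∧
          (AlgPoints.prodEquiv.symm (q.2, (q.1.1 : Motives.ComplexPoints T)) :
            Motives.ComplexPoints (𝒳 ⊗ T)).pt ∉ 𝒵} => ((q.1.1 : Motives.ComplexPoints T), q.1.2))
    (((IsEmbedding.subtypeVal.prodMap IsEmbedding.id).comp
      (IsEmbedding.subtypeVal.comp (IsEmbedding.subtypeVal.comp IsEmbedding.subtypeVal))))
    ((IsEmbedding.subtypeVal.prodMap IsEmbedding.id).comp IsEmbedding.subtypeVal) (by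
      ext ⟨t, x⟩
      constructor
      · rintro ⟨⟨z, hzV⟩, hz⟩
        have hz' : ((((z.1 : TotP).1.1 : ↥W') : Motives.ComplexPoints T), (z.1 : TotP).1.2) = (t, x) := hz
        obtain ⟨rfl, rfl⟩ := Prod.mk.inj hz'
        exact ⟨⟨(⟨(((z.1 : TotP).1.1 : ↥W') : Motives.ComplexPoints T), ⟨_, hzV, rfl⟩⟩,
          (z.1 : TotP).1.2), (z.1 : TotP).2.1, (z.1 : TotP).2.2⟩, rfl⟩
      · rintro ⟨⟨⟨t', x'⟩, hq⟩, htx⟩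
        have htx' : ((t' : Motives.ComplexPoints T), x') = (t, x) := htx
        obtain ⟨rfl, rfl⟩ := Prod.mk.inj htx'
        have hwV₁ : (⟨t'.1, hVW' t'.2⟩ : ↥W') ∈ V₁ := hmemV₁ t'
        exact ⟨⟨⟨⟨((⟨t'.1, hVW' t'.2⟩ : ↥W'), x'), hq⟩, hV₁U₁ hwV₁⟩, hwV₁⟩, rfl⟩)
  refine ⟨e₁.trans (φV.trans e₂), fun x => ?_⟩
  -- the first component is preserved
  apply Subtype.ext
  have h1 : ((((e₁ x).1.1 : ↥W') : Motives.ComplexPoints T)) = (x.1 : Motives.ComplexPoints T) :=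
    congrArg Prod.fst (he₁ x)
  have h2 : ((((φV (e₁ x)).1 : TotP).1.1 : ↥W') : Motives.ComplexPoints T) =
      (((e₁ x).1.1 : ↥W') : Motives.ComplexPoints T) := by
    rw [hφV]
    exact congrArg (fun w : ↥W' => (w : Motives.ComplexPoints T)) (hφ₁ (e₁ x).1)
  have h3 : (((e₂ (φV (e₁ x))).1.1 : Motives.ComplexPoints T)) =
      ((((φV (e₁ x)).1 : TotP).1.1 : ↥W') : Motives.ComplexPoints T) :=
    congrArg Prod.fst (he₂ (φV (e₁ x)))
  exact h3.trans (h2.trans h1)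

end Bridge

/-! ### The target from Mumford's lemma -/

section Capstone

/-- **`charlesSchnell_algebraicityLocus_iUnion_closed` from Mumford's curve lemma** (Mumford,
*Abelian Varieties*, §6, Lemma: a smooth complete curve through two points of an irreducible
variety — the named fact `Motives.mumford_smoothCurve_through_two_points`, the only input not
proved here). The proof is that of
`charlesSchnell_algebraicityLocus_iUnion_closed_of_mumford_of_verdier`
(`AlgebraicityLocusFromMumfordVerdier`: hyperplane witness families, completeness of the
witnesses, assembly `algebraicityLocus_eq_iUnion_of_dichotomy`, uniform codimension
`codim_dichotomy_of_isPreimmersion`), with Verdier's pair triviality replaced by the generic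
local triviality of the complement of the closed subfamily (`complTrivialisation_generic`:
embedded log resolution, generic smoothness of snc strata in characteristic zero, Ehresmann
relative to an snc boundary), which gives the dichotomy by `dichotomy_of_complTrivialisation`.
[cite: CharlesSchnell2014Notes, Prop. 11.3.11 (proof)] [cite: VoisinHodgeII2003, §3.3.1 and §7.3.2]
[cite: VoisinHodgeI2002, §9.1.1] [cite: MumfordAV1970, §6, Lemma] -/
theorem charlesSchnell_algebraicityLocus_iUnion_closed_of_mumford
    (hM : Motives.mumford_smoothCurve_through_two_points) :
    charlesSchnell_algebraicityLocus_iUnion_closed := by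
  intro 𝒳 S f n p h𝒳 hS hSsm hfam A
  -- the standing instances
  haveI : Smooth S.hom := hSsm
  haveI : IsProper f.left := hfam.isProper
  haveI : SmoothOfRelativeDimension n f.left := hfam.smoothOfRelativeDimension
  obtain ⟨P', j', hP', hj'⟩ := hS
  haveI : IsProper P'.hom := hP'.isProper
  haveI : IsSeparated S.hom := by
    rw [show S.hom = j'.left ≫ P'.hom from (Over.w j').symm]
    infer_instance
  have hS : IsQuasiProjectiveOver S := ⟨P', j', hP', hj'⟩
  haveI : IsSeparated 𝒳.hom := by
    rw [show 𝒳.hom = f.left ≫ S.hom from (Over.w f).symm]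
    infer_instance
  -- the embedding `ε : 𝒳 ⟶ ℙᴺ` (open immersion into a projective scheme, then its embedding)
  obtain ⟨P, j, hP, hj⟩ := h𝒳
  obtain ⟨N, ι, hι⟩ := hP
  haveI := hj
  haveI := hι
  have h𝒳 : IsQuasiProjectiveOver 𝒳 := ⟨P, j, ⟨N, ι, hι⟩, hj⟩
  set ε : 𝒳 ⟶ projectiveSpace N ℂ := j ≫ ι with hεdef
  have hε : IsEmbedding ε.left.base := by
    rw [hεdef, Over.comp_left, Scheme.Hom.comp_base, TopCat.coe_comp]
    exact ι.left.isClosedEmbedding.isEmbedding.comp j.left.isOpenEmbedding.isEmbedding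
  haveI hεpre : IsPreimmersion ε.left := by
    rw [hεdef, Over.comp_left]
    infer_instance
  -- the witness families, indexed by `(d, m)`
  let H : ℕ × ℕ → Motives.SchemeOver ℂ := fun i => (hyperplaneFamily f ε i.1 i.2).T
  let h : ∀ i, H i ⟶ S := fun i => (hyperplaneFamily f ε i.1 i.2).h
  let 𝒵 : ∀ i, Set (𝒳 ⊗ H i).left := fun i => (hyperplaneFamily f ε i.1 i.2).𝒵
  haveI : ∀ i, IsProper (h i).left := fun i => isProper_hyperplaneFamily_h f ε i.1 i.2
  haveI hlft : ∀ i, LocallyOfFiniteType (H i).hom := fun i => by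
    rw [← Over.w (h i)]
    infer_instance
  -- the good sets: codimension `≥ p` slices off which `A` dies
  let Good : ∀ i, Set (Motives.ComplexPoints (H i)) := fun i =>
    {y | (∀ x : 𝒳.left, (sliceAt 𝒳 y).left.base x ∈ 𝒵 i → height x + p ≤ (n : ℕ∞)) ∧
      complexBetti.map (Motives.fiberι f (AlgPoints.map (h i) y)) (2 * p) A ∈
        LinearMap.ker (complexBetti.restrictCompl (Motives.fiberOver f (AlgPoints.map (h i) y))
          ((lift (Motives.fiberι f (AlgPoints.map (h i) y))
            (Motives.fiberOverToSpec f (AlgPoints.map (h i) y) ≫ y)).left.base ⁻¹' 𝒵 i)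
              (2 * p)).hom}
  refine algebraicityLocus_eq_iUnion_of_dichotomy f hM hfam hS hSsm p A H h 𝒵
    (fun i => isClosed_hyperplaneFamily_𝒵 f ε i.1 i.2) Good (fun i y hy => hy) ?_ ?_
  · -- completeness of the witnesses
    intro t ht
    obtain ⟨Z, hZc, hZp, hZ0⟩ := mem_supportedClasses_iff_exists.1 ht
    obtain ⟨d, m, y, hyt, hZy⟩ := exists_tuplePoint_forall_mem_iff f ε hε t hZc
    refine ⟨(d, m), y, ?_, hyt⟩
    subst hyt
    refine ⟨fun x hx => ?_, ?_⟩
    · -- codimension: `x` lies over `h(y)`, is `ι_t z` with `z ∈ Z`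
      have hfx : f.left.base x = (AlgPoints.map (hyperplaneFamily f ε d m).h y).pt :=
        apply_eq_pt_of_sliceAt_mem_hyperplaneFamily_𝒵 f ε d m y x hx
      obtain ⟨z, rfl⟩ := exists_fiberι_base_eq f _ x hfx
      have hz : z ∈ Z := (hZy z).2 hx
      rw [height_fiberι_base_eq f _ z,
        ← le_coheight_iff_height_add_le (hfam.isSmoothProjective _) z p]
      exact hZp z hz
    · -- dies off the slice, which is `Z`
      have hslice : (lift (Motives.fiberι f (AlgPoints.map (hyperplaneFamily f ε d m).h y))
          (Motives.fiberOverToSpec f (AlgPoints.map (hyperplaneFamily f ε d m).h y) ≫ y)).left.base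
            ⁻¹' (hyperplaneFamily f ε d m).𝒵 = Z := by
        ext z
        rw [Set.mem_preimage, lift_fiberι_base_apply]
        exact (hZy z).symm
      change complexBetti.map (Motives.fiberι f (AlgPoints.map (hyperplaneFamily f ε d m).h y))
          (2 * p) A ∈
        LinearMap.ker (complexBetti.restrictCompl
          (Motives.fiberOver f (AlgPoints.map (hyperplaneFamily f ε d m).h y))
          ((lift (Motives.fiberι f (AlgPoints.map (hyperplaneFamily f ε d m).h y))
            (Motives.fiberOverToSpec f (AlgPoints.map (hyperplaneFamily f ε d m).h y) ≫
              y)).left.base ⁻¹' (hyperplaneFamily f ε d m).𝒵) (2 * p)).hom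
      rw [hslice]
      exact LinearMap.mem_ker.2 hZ0
  · -- the generic dichotomy on irreducible closed subsets of the parameter spaces
    rintro ⟨d, m⟩ Y hYc hY
    haveI : LocallyOfFiniteType (hyperplaneFamily f ε d m).T.hom := hlft (d, m)
    haveI : IsProper (hyperplaneFamily f ε d m).h.left := isProper_hyperplaneFamily_h f ε d m
    haveI : IsSeparated (hyperplaneFamily f ε d m).T.hom := by
      rw [← Over.w (hyperplaneFamily f ε d m).h]
      infer_instance
    haveI : NoetherianSpace (hyperplaneFamily f ε d m).T.left :=
      noetherianSpace_of_isProper_of_isQuasiProjectiveOver (hyperplaneFamily f ε d m).h hS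
    haveI : CompactSpace (hyperplaneFamily f ε d m).T.left := inferInstance
    obtain ⟨OV, hYOV, hVO⟩ := complTrivialisation_generic f (hyperplaneFamily f ε d m).h (n := n)
      (hyperplaneFamily f ε d m).𝒵 (isClosed_hyperplaneFamily_𝒵 f ε d m) hYc hY
    obtain ⟨OC, hYOC, hCO⟩ := codim_dichotomy_of_isPreimmersion f (hyperplaneFamily f ε d m).h ε
      (isClosed_hyperplaneFamily_𝒵 f ε d m) (apply_eq_pt_of_sliceAt_mem_hyperplaneFamily_𝒵 f ε d m)
      p n hY
    have hYO : (Y ∩ ((OV ⊓ OC : (hyperplaneFamily f ε d m).T.left.Opens) : Set _)).Nonempty := by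
      obtain ⟨q, hqY, hq⟩ := hY.isPreirreducible _ _ OV.2 OC.2
        (by obtain ⟨q, hqY, hq⟩ := hYOV; exact ⟨q, hqY, hq⟩)
        (by obtain ⟨q, hqY, hq⟩ := hYOC; exact ⟨q, hqY, hq⟩)
      exact ⟨q, hqY, hq⟩
    refine ⟨((OV ⊓ OC : (hyperplaneFamily f ε d m).T.left.Opens) : Set _), (OV ⊓ OC).2, ?_, ?_⟩
    · obtain ⟨q, hqY, hq⟩ := hYO
      exact ⟨q, hq, hqY⟩
    rcases hCO with hgoodC | hbadC
    · -- codimension uniform: the dichotomy for the vanishing condition (complement triviality)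
      have hdich := dichotomy_of_complTrivialisation f (hyperplaneFamily f ε d m).h
        (hyperplaneFamily f ε d m).𝒵 (2 * p) A hYc hY (OV ⊓ OC) hYO
        (hVO (OV ⊓ OC) inf_le_left)
      rcases hdich with hall | hnone
      · refine Or.inl fun y hy => ⟨hgoodC y ⟨hy.2, hy.1.2⟩, hall y ⟨hy.2, hy.1⟩⟩
      · refine Or.inr fun y hy hgood => hnone y ⟨hy.2, hy.1⟩ hgood.2
    · exact Or.inr fun y hy hgood => hbadC y ⟨hy.2, hy.1.2⟩ hgood.1


/-- **Discharge of the named fact `charlesSchnell_algebraicityLocus_iUnion_closed`** (Charles–Schnell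
2014, Prop. 11.3.11; Voisin, *Hodge Theory II*, §3.3.1 and §7.3.2): for a smooth projective family
`f : 𝒳 → S` of quasi-projective complex varieties over a smooth `S` and a class
`A ∈ H²ᵖ(𝒳(ℂ); ℂ)`, the locus of `t ∈ S(ℂ)` where `A|_{𝒳_t}` is algebraic is a countable union of
complex points of Zariski-closed subsets of `S` — from
`charlesSchnell_algebraicityLocus_iUnion_closed_of_mumford` and Mumford's curve lemma, a theorem
of the tree (`Motives.mumford_smoothCurve_through_two_points_holds`).
[cite: CharlesSchnell2014Notes, Prop. 11.3.11] [cite: VoisinHodgeII2003, §3.3.1 and §7.3.2]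
[cite: MumfordAV1970, §6, Lemma] -/
theorem charlesSchnell_algebraicityLocus_iUnion_closed_holds :
    charlesSchnell_algebraicityLocus_iUnion_closed :=
  charlesSchnell_algebraicityLocus_iUnion_closed_of_mumford
    Motives.mumford_smoothCurve_through_two_points_holds

end Capstone




end Part3

end Literature.AlgebraicGeometry.HodgeTheory

end
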